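import Mathlib
import Literature.NumberTheory.LFunctions.Zhang2022.TypedSection15A
import Literature.NumberTheory.LFunctions.Zhang2022.Section14GaussSums
import Literature.NumberTheory.LFunctions.Zhang2022.Section8Ded81Prelims
import Literature.NumberTheory.LFunctions.Zhang2022.Section7bDischarges
import Literature.NumberTheory.LFunctions.Zhang2022.Section5DeltaRapidDecayTail
import Literature.NumberTheory.Sieve.DivisorBound
import Literature.NumberTheory.LFunctions.Zhang2022.Section7KappaEulerLocal
import HarnessLib

/-!
# Zhang (2022) §15 part A — kernel-checked identities and edges, companion of `TypedSection15A`

Topic `Literature/NumberTheory/LFunctions/Zhang2022` (Landau–Siegel audit tree; verdict-neutral).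
Y. Zhang, *Discrete mean estimates and the Landau–Siegel zero*, arXiv:2211.02515v1 (2022)
[Zhang2022LandauSiegel] — **an unrefereed manuscript under adjudication** (cell siegel-zhang, D-0069;
DAG node ids `Z22:…` of `plan/DAG.tsv`). This theorem-only leaf DISCHARGES claims typed in
`Zhang2022/TypedSection15A.lean` whose proofs need imports the typed statement file should not carry
(the Gauss-sum/CRT toolkit behind `Zhang2022/Section14GaussSums.lean`, the Mellin analysis of `Δ`
in `Zhang2022/Section5DeltaRapidDecayTail.lean`, the `#Ψ₁ ≤ 𝔓` count of
`Zhang2022/Section8Ded81Prelims.lean`, `#{p∼P}·P ≤ 𝔓` of `Zhang2022/Section7bDischarges.lean`),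
and lands the in-slice DEDUCTION EDGES of the proof of
(15.4) and (15.3):

* `Z22:§15.u005` [Z22 p. 80, tex L4021]: "the relation `τ(χψ) = τ(χ)τ(ψ)ψ(D)χ(p)`" for the
  character `χψ (mod Dp)` (`Skeleton.psiChi`, the product of the two characters lifted to `Dp`) and
  `(D, p) = 1` — Montgomery–Vaughan Theorem 9.6 for lifted characters, the tree's
  `Typed.Sec14.gaussSum_changeLevel_mul_changeLevel` [cite: MontgomeryVaughan2007, Theorem 9.6];
  `step15_u005_holds : Step15_u005`, UNCONDITIONAL.
* `Z22:§15.u007` [Z22 p. 80, tex L4029]: "for `σ < 0`, `L(1−s−β₁,ψ̄)L(1−s−β₂,ψ̄)K(1−s−β₃,ψ̄)/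
  L(1−s,ψ̄) = Σ_m k̃(m)ψ̄(m)m^{s−1}` with `k̃(m) ≪ τ₄(m)`" — `step15_u007_holds : Step15_u007 c'`
  (`C = 1`, `D ≥ 2`), from the tree's twisted product rule `LSeries_twist_conv_kappa₁` at `w = 1 − s`
  and the divisor majorant `norm_seqConv_le_tau`; UNCONDITIONAL.
* `Z22:(15.8)` [Z22 p. 82, tex L4109]: "the innermost sum is, by the Mellin transform, equal to
  `(1/2πi)∫_{(2)} (Σ_{(l₁,d₂k)=1} κ₁(d₁l₁)χ(l₁)l₁^{−s})(Dpk/l₂)^s δ(s) ds`" — `eq15_8_holds : Eq15_8 c'`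
  (`D ≥ 3`): Mellin inversion of `Δ` on `σ = 2` (`DeltaW_eq_mellinInv_two`, vertical integrability
  from Lemma 5.4 (i)) and `Σ_{l₁}∫ = ∫Σ_{l₁}` by dominated convergence (`Σ τ₃(n)/n² < ∞`,
  `summable_tau_three_div_sq`, from the divisor bound [cite: HardyWright2008, Theorem 315]).
* `Z22:§15.u019` [Z22 p. 82, tex L4103]: "This yields `Σ_{(l,k)=1}(κ₁∗b)(dl)χ(l)Δ(l/(Dpk)) =
  Σ_{d=d₁d₂}Σ_{(l₂,k)=1} b(d₂l₂)χ(l₂)Σ_{(l₁,d₂k)=1} κ₁(d₁l₁)χ(l₁)Δ(l₁l₂/(Dpk))`" —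
  `step15_u019_lit_holds : Step15_u019 c' bLit` (the printed `b`) and `step15_u019_chi_holds`
  (`χ·b`), from `step15_u019_of_support` (any finitely supported `b`): `§15.u018` termwise and the
  rearrangement of the absolutely convergent double series over `(l₁, l₂)` (`|Δ(x)| ≤ C_Δx⁻²`,
  `norm_DeltaW_le_div_sq`; `dk < 2P₄` forces `D ≥ 3`, `three_le_of_one_lt_two_mul_P4`).
* `Z22:§15.u020` [Z22 p. 82, tex L4114]: the splitting `l₁ = hl` (`h ∈ 𝔫(d₁)`, `(l,d₁) = 1`) and
  "`Σ_{(l₁,d₂k)=1} κ₁(d₁l₁)χ(l₁)l₁^{−s} = κ̃₁(d₁;d₂k,s)Σ_{(l,d₁d₂k)=1}κ₁(l)χ(l)l^{−s} =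
  κ̃₁(d₁;d₂k,s)λ₁(d₁d₂k,s)L(s+β₁,χ)L(s+β₂,χ)/L(s,χ)`" (`σ > 1`) — `step15_u020_holds : Step15_u020 c'`
  (both equalities, every `D`), via the tree's splitting `KappaEuler.exists_split` /
  `convolution_eq_of_split` for the multiplicative `χ·κ₁` (`split_conv_apply_kappa1`) and, for the
  Euler factor `λ₁`, the level change `χ ↦ χ (mod D·M)` (`tsum_coprime_kappa1_chi`:
  `MeanSquareMajorant.LSeries_twist_kappa₁` + Mathlib's `DirichletCharacter.LSeries_changeLevel`).
* EDGE `Z22:(15.3) ⇐ Z22:§15.u002` (`eq15_3_of_u002`): summing the per-character residue identity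
  `Σ_ρ 𝔨₁*(ρ,ψ)ω(ρ) = I₂⁺(ψ) − I₂⁻(ψ) + O(ε)` over `ψ ∈ Ψ₁` costs the factor `#Ψ₁ ≤ 𝔓 ≤ 2P² =
  2exp{2𝓛⁹}`, absorbed by `ε = exp{−c𝓛¹⁰}` (with `c ↦ c/2`) [Z22 p. 80, tex L4007; §4 p. 17].
* EDGE `Z22:(15.4) ⇐ Z22:§15.u008 + §15.u009 + §15.u012` (`eq15_4_of`): the two `o(𝔓)` moves
  (u008, u009) and the bound `Σ*_{ψ (mod p)}(…) ≪ PD^{−4/5}` (u012) at each `p ∼ P`, with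
  `|τ(χ)| = √D`, `|χ(p)| ≤ 1`, `|(pt₀)^{−β₃}| = 1` (`β₃ ∈ iℝ`) and `#{p ∼ P}·P ≤ 𝔓`, give
  `Σ_{ψ∈Ψ₁} I₂⁻(ψ) = o(𝔓)` [Z22 pp. 80–81]. The regrouping `Σ_{ψ∈Ψ} = Σ_{p∼P} Σ*_{ψ (mod p)}`
  is `finsum_chr_eq_sum_attach_sumPrim`.

Nothing here bears on Theorems 1–2 of the source or on the cell's verdict: the edges take the
printed displays as hypotheses.

## References

* Y. Zhang, arXiv:2211.02515v1 (2022), §15 pp. 79–81; §4 p. 17 (ε); §2 (2.9).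
  [cite: Zhang2022LandauSiegel, §15 pp. 79–81]
* H. L. Montgomery, R. C. Vaughan, *Multiplicative Number Theory I* (2007), Theorem 9.6.
  [cite: MontgomeryVaughan2007, Theorem 9.6]
* G. H. Hardy, E. M. Wright, *An Introduction to the Theory of Numbers* (6th ed., 2008), Theorem 315
  (the divisor bound). [cite: HardyWright2008, Theorem 315]
-/

noncomputable section

open Complex Real ComplexConjugate

namespace Literature.NumberTheory.LFunctions.Zhang2022.Typed.Section15A

open Literature.NumberTheory.LFunctions.Zhang2022.Skeleton

/-! ## `Z22:§15.u005`: the Gauss sum of `χψ (mod Dp)` -/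

/-- **`Z22:§15.u005` DISCHARGED**: `τ(χψ) = τ(χ)τ(ψ)ψ(D)χ(p)` for `χ (mod D)`, `ψ (mod p)`, `p ∼ P`,
`(D,p) = 1`, with `χψ` the product character to the modulus `Dp` (`Skeleton.psiChi`) and `τ` the
Gauss sum against `e(·/q)` (`GammaFactor.tau`) — Montgomery–Vaughan Theorem 9.6.
[cite: Zhang2022LandauSiegel, §15 p. 80] [cite: MontgomeryVaughan2007, Theorem 9.6] -/
theorem step15_u005_holds : Step15_u005 := by
  intro D _ χ x hcop
  rw [GammaFactor.tau, GammaFactor.tau, GammaFactor.tau, psiChi,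
    Typed.Sec14.gaussSum_changeLevel_mul_changeLevel hcop]
  ring

/-! ## EDGE `(15.3) ⇐ §15.u002` -/

section Edge153

/-- `L₀ ≤ log D` once `D ≥ ⌈exp L₀⌉₊`. [folklore] -/
private theorem le_log_of_ceil_exp_le' {L₀ : ℝ} {D : ℕ} (hD : ⌈Real.exp L₀⌉₊ ≤ D) :
    L₀ ≤ Real.log D := by
  have h : Real.exp L₀ ≤ D := le_trans (Nat.le_ceil _) (by exact_mod_cast hD)
  exact (Real.le_log_iff_exp_le (lt_of_lt_of_le (Real.exp_pos _) h)).mpr h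

/-- **`𝔓 ≤ 2P²` for large `D`** ((2.9): `𝔓 = (1 + O(𝓛⁻⁶⁸))P²𝓛⁻⁷⁷`, the tree's `frakP_bounds`).
[cite: Zhang2022LandauSiegel, §2 (2.9)] -/
theorem frakP_le_two_mul_bigP_sq : ∃ D₀ : ℕ, ∀ D : ℕ, D₀ ≤ D → frakP D ≤ 2 * bigP D ^ 2 := by
  obtain ⟨D₀, h⟩ := frakP_bounds
  refine ⟨max D₀ ⌈Real.exp 2⌉₊, fun D hD => ?_⟩
  have hD₀ : D₀ ≤ D := le_trans (le_max_left _ _) hD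
  have hL2 : (2 : ℝ) ≤ Real.log D := le_log_of_ceil_exp_le' (le_trans (le_max_right _ _) hD)
  have hb := (abs_le.mp (h D hD₀)).2
  have hP : bigP D = Real.exp (Real.log D ^ 9) := by rw [bigP, ell]
  rw [hP]
  set L := Real.log D with hL
  set M := Real.exp (L ^ 9) ^ 2 * (L ^ 77)⁻¹ with hM
  have hM0 : 0 ≤ M := by positivity
  have hL68 : 3 * (L ^ 68)⁻¹ ≤ 1 := by
    have h68 : (2 : ℝ) ^ 68 ≤ L ^ 68 := pow_le_pow_left₀ (by norm_num) hL2 68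
    rw [mul_inv_le_iff₀ (by positivity), one_mul]
    linarith [show (3 : ℝ) ≤ 2 ^ 68 by norm_num]
  have hMP : M ≤ Real.exp (L ^ 9) ^ 2 := by
    have h77 : (1 : ℝ) ≤ L ^ 77 := one_le_pow₀ (by linarith)
    calc M = Real.exp (L ^ 9) ^ 2 * (L ^ 77)⁻¹ := hM
      _ ≤ Real.exp (L ^ 9) ^ 2 * 1 :=
          mul_le_mul_of_nonneg_left (inv_le_one_of_one_le₀ h77) (by positivity)
      _ = Real.exp (L ^ 9) ^ 2 := mul_one _
  have h3 : 3 * (L ^ 68)⁻¹ * M ≤ M := by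
    calc 3 * (L ^ 68)⁻¹ * M ≤ 1 * M := mul_le_mul_of_nonneg_right hL68 hM0
      _ = M := one_mul _
  linarith

/-- **EDGE `Z22:(15.3) ⇐ Z22:§15.u002`**: summing "`Σ_{ρ∈𝔷(ψ)} 𝔨₁*(ρ,ψ)ω(ρ) = I₂⁺(ψ) − I₂⁻(ψ) + O(ε)`"
over `ψ ∈ Ψ₁` (`Φ₁ = Σ_{ψ∈Ψ₁}Σ_ρ 𝔨₁*(ρ,ψ)ω(ρ)`, (13.8)) gives "`Φ₁ = Σ_{ψ∈Ψ₁}(I₂⁺(ψ) − I₂⁻(ψ)) +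
O(ε)`": the `#Ψ₁ ≤ 𝔓 ≤ 2P² = 2e^{2𝓛⁹}` copies of `ε = e^{−c𝓛¹⁰}` are `≤ 2e^{−(c/2)𝓛¹⁰}` once
`𝓛 ≥ 4/c`. [cite: Zhang2022LandauSiegel, §15 (15.3) p. 80] -/
theorem eq15_3_of_u002 (c' : ℝ) (h : Step15_u002 c') : Eq15_3 c' := by
  obtain ⟨c, hc, C, D₀, hD₀⟩ := h
  obtain ⟨D₁, hD₁⟩ := frakP_le_two_mul_bigP_sq
  refine ⟨c / 2, by positivity, 2 * max C 0, max D₀ (max D₁ ⌈Real.exp (4 / c)⌉₊),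
    fun D _ χ hD hq hp hA => ?_⟩
  have hb := hD₀ D χ (le_trans (le_max_left _ _) hD) hq hp hA
  have hfrakP := hD₁ D (le_trans (le_trans (le_max_left _ _) (le_max_right _ _)) hD)
  have hℓ : 4 / c ≤ ell D := by
    rw [ell]
    exact le_log_of_ceil_exp_le' (le_trans (le_trans (le_max_right _ _) (le_max_right _ _)) hD)
  have hℓ0 : 0 < ell D := lt_of_lt_of_le (by positivity) hℓ
  set E : ℝ := Real.exp (-c * ell D ^ 10) with hE
  have hE0 : 0 < E := Real.exp_pos _
  have hC : C ≤ max C 0 := le_max_left _ _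
  have hC0 : 0 ≤ max C 0 := le_max_right _ _
  have hPhi : Phi1 c' χ = ∑ x ∈ finsetOf (PsiOne χ),
      ∑ ρ ∈ finsetOf (zeroSet D x), kstar1 c' χ x ρ * omegaW D ρ := by
    rw [Phi1, idx, Finset.sum_sigma]
  rw [hPhi, ← Finset.sum_sub_distrib]
  -- the count: `#Ψ₁ · ε ≤ 𝔓 ε ≤ 2P² ε ≤ 2 e^{−(c/2)𝓛¹⁰}`
  have hcount : ((finsetOf (PsiOne χ)).card : ℝ) * (max C 0 * E) ≤
      2 * max C 0 * Real.exp (-(c / 2) * ell D ^ 10) := by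
    have h1 : ((finsetOf (PsiOne χ)).card : ℝ) ≤ 2 * bigP D ^ 2 :=
      le_trans (Ded81Edge.card_finsetOf_psiOne_le_frakP χ) hfrakP
    have h2 : bigP D ^ 2 * E ≤ Real.exp (-(c / 2) * ell D ^ 10) := by
      rw [hE, bigP, ← Real.exp_nat_mul, ← Real.exp_add, Real.exp_le_exp]
      have h9 : 0 < ell D ^ 9 := by positivity
      have hcl : 4 ≤ c * ell D := by
        have := (div_le_iff₀ hc).mp hℓ
        linarith
      have : (2 : ℝ) * ell D ^ 9 ≤ (c / 2) * ell D ^ 10 := by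
        have : (c / 2) * ell D ^ 10 = (c * ell D / 2) * ell D ^ 9 := by ring
        rw [this]
        exact mul_le_mul_of_nonneg_right (by linarith) h9.le
      push_cast
      linarith
    calc ((finsetOf (PsiOne χ)).card : ℝ) * (max C 0 * E)
        ≤ 2 * bigP D ^ 2 * (max C 0 * E) := mul_le_mul_of_nonneg_right h1 (by positivity)
      _ = 2 * max C 0 * (bigP D ^ 2 * E) := by ring
      _ ≤ 2 * max C 0 * Real.exp (-(c / 2) * ell D ^ 10) :=
          mul_le_mul_of_nonneg_left h2 (by positivity)
  calc ‖∑ x ∈ finsetOf (PsiOne χ), ((∑ ρ ∈ finsetOf (zeroSet D x), kstar1 c' χ x ρ * omegaW D ρ) -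
          (I2pm c' χ x (alpha D) - I2pm c' χ x (-alpha D)))‖
      ≤ ∑ x ∈ finsetOf (PsiOne χ), ‖(∑ ρ ∈ finsetOf (zeroSet D x), kstar1 c' χ x ρ * omegaW D ρ) -
          (I2pm c' χ x (alpha D) - I2pm c' χ x (-alpha D))‖ := norm_sum_le _ _
    _ ≤ ∑ x ∈ finsetOf (PsiOne χ), max C 0 * E :=
        Finset.sum_le_sum fun x hx =>
          le_trans (hb x (mem_of_mem_finsetOf hx)) (mul_le_mul_of_nonneg_right hC hE0.le)
    _ = ((finsetOf (PsiOne χ)).card : ℝ) * (max C 0 * E) := by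
        rw [Finset.sum_const, nsmul_eq_mul]
    _ ≤ 2 * max C 0 * Real.exp (-(c / 2) * ell D ^ 10) := hcount

end Edge153

/-! ## EDGE `(15.4) ⇐ §15.u008 + §15.u009 + §15.u012` -/

section Edge154

/-- Constants are pulled out of `Σ*_{ψ (mod p)}`. [folklore] -/
private theorem sumPrim_const_mul {p : ℕ} (a : ℂ) (F : (ψ : DirichletCharacter ℂ p) → ψ.IsPrimitive → ℂ) :
    sumPrim (fun ψ h => a * F ψ h) = a * sumPrim F := by
  rw [sumPrim, sumPrim, finsum_eq_sum_of_fintype, finsum_eq_sum_of_fintype, Finset.mul_sum]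
  refine Finset.sum_congr rfl fun ψ _ => ?_
  split_ifs <;> simp

/-- **`Σ_{ψ∈Ψ} G(ψ) = Σ_{p∼P} Σ*_{ψ (mod p)} G(p,ψ)`**: the family `Ψ` (`Skeleton.Chr D`) is the
disjoint union over the window primes of the primitive characters to each modulus (§2 p. 4).
[cite: Zhang2022LandauSiegel, §2 p. 4] -/
theorem finsum_chr_eq_sum_attach_sumPrim {D : ℕ} (G : Chr D → ℂ) :
    ∑ᶠ x : Chr D, G x =
      ∑ q ∈ (primeWindow D).attach,
        sumPrim fun (ψ : DirichletCharacter ℂ q) hψ => G ⟨q, q.2, ψ, hψ⟩ := by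
  classical
  haveI : Fintype (Chr D) := Fintype.ofFinite _
  -- the summand on the ambient finite type `Σ_{q ∈ window} (characters mod q)`
  have key : ∀ G' : ((q : primeWindow D) × DirichletCharacter ℂ (q : ℕ)) → ℂ,
      (∀ y, G' y = if h : y.2.IsPrimitive then G ⟨y.1, y.1.2, y.2, h⟩ else 0) →
      ∑ x : Chr D, G x = ∑ y, G' y := by
    intro G' hG'
    have hinj : Set.InjOn (Chr.toSigma (D := D)) ↑(Finset.univ : Finset (Chr D)) := by
      rintro ⟨p, hp, ψ, hψ⟩ _ ⟨p', hp', ψ', hψ'⟩ _ h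
      simp only [Chr.toSigma, Sigma.mk.injEq, Subtype.mk.injEq] at h
      obtain ⟨rfl, h2⟩ := h
      simp only [heq_eq_eq] at h2
      subst h2
      rfl
    have h1 : ∑ x : Chr D, G x = ∑ x : Chr D, G' (Chr.toSigma x) := by
      refine Finset.sum_congr rfl fun x _ => ?_
      rw [hG', Chr.toSigma, dif_pos x.prim]
    have h2 : ∑ x : Chr D, G' (Chr.toSigma x) =
        ∑ y ∈ (Finset.univ : Finset (Chr D)).image Chr.toSigma, G' y :=
      (Finset.sum_image hinj).symm
    have h3 : ∑ y ∈ (Finset.univ : Finset (Chr D)).image Chr.toSigma, G' y = ∑ y, G' y := by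
      refine Finset.sum_subset (Finset.subset_univ _) fun y _ hy => ?_
      rw [hG', dif_neg]
      intro h
      exact hy (Finset.mem_image.mpr ⟨⟨y.1, y.1.2, y.2, h⟩, Finset.mem_univ _, rfl⟩)
    rw [h1, h2, h3]
  rw [finsum_eq_sum_of_fintype,
    key (fun y => if h : y.2.IsPrimitive then G ⟨y.1, y.1.2, y.2, h⟩ else 0) (fun y => rfl),
    Fintype.sum_sigma, Finset.attach_eq_univ]
  refine Finset.sum_congr rfl fun q _ => ?_
  rw [sumPrim, finsum_eq_sum_of_fintype]

/-- `|(pt₀)^{−β₃}| = 1`: `β₃ = iα₃` is purely imaginary and `pt₀ > 0`.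
[cite: Zhang2022LandauSiegel, §2 (2.13)] -/
theorem norm_mul_t0_cpow_neg_beta3 (c' : ℝ) {D p : ℕ} (hp : 0 < p) (ht : 0 < t0 D) :
    ‖((((p : ℝ) * t0 D : ℝ)) : ℂ) ^ (-beta3 c' D)‖ = 1 := by
  have hpos : 0 < (p : ℝ) * t0 D := mul_pos (by exact_mod_cast hp) ht
  have hβ₃ : beta3 c' D = (b3 c' D : ℂ) * I := by simp only [beta3, b3]; push_cast; ring
  rw [Complex.norm_cpow_eq_rpow_re_of_pos hpos, hβ₃]
  simp

/-- The main-term bound behind (15.4): if `|a(p)| ≤ 1` for `p ∼ P` and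
`|Σ*_{ψ (mod p)} L(ψ)| ≤ B` for each `p ∼ P`, then `|Σ_{ψ∈Ψ} a(p_ψ)L(ψ)| ≤ #{p∼P}·B`.
[cite: Zhang2022LandauSiegel, §15 p. 81] -/
theorem norm_finsum_chr_window_le {D : ℕ} (a : ℕ → ℂ) (L : Chr D → ℂ) {B : ℝ}
    (ha : ∀ p ∈ primeWindow D, ‖a p‖ ≤ 1)
    (hL : ∀ (p : ℕ) (hp : p ∈ primeWindow D),
      ‖sumPrim fun (ψ : DirichletCharacter ℂ p) hψ => L ⟨p, hp, ψ, hψ⟩‖ ≤ B) :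
    ‖∑ᶠ x : Chr D, a x.p * L x‖ ≤ (primeWindow D).card * B := by
  rw [finsum_chr_eq_sum_attach_sumPrim]
  show ‖∑ q ∈ (primeWindow D).attach,
      sumPrim fun (ψ : DirichletCharacter ℂ q) hψ => a q * L ⟨q, q.2, ψ, hψ⟩‖ ≤ _
  calc ‖∑ q ∈ (primeWindow D).attach,
          sumPrim fun (ψ : DirichletCharacter ℂ q) hψ => a q * L ⟨q, q.2, ψ, hψ⟩‖
      ≤ ∑ q ∈ (primeWindow D).attach,
          ‖sumPrim fun (ψ : DirichletCharacter ℂ q) hψ => a q * L ⟨q, q.2, ψ, hψ⟩‖ :=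
        norm_sum_le _ _
    _ ≤ ∑ q ∈ (primeWindow D).attach, B := Finset.sum_le_sum fun q _ => by
        rw [sumPrim_const_mul, norm_mul]
        calc ‖a q‖ * ‖sumPrim fun (ψ : DirichletCharacter ℂ q) hψ => L ⟨q, q.2, ψ, hψ⟩‖
            ≤ 1 * B := mul_le_mul (ha q q.2) (hL q q.2) (norm_nonneg _) zero_le_one
          _ = B := one_mul B
    _ = (primeWindow D).card * B := by
        rw [Finset.sum_const, Finset.card_attach, nsmul_eq_mul]

/-- **EDGE `Z22:(15.4) ⇐ Z22:§15.u008 + §15.u009 + §15.u012`** (the proof of (15.4), pp. 80–81):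
`Σ_{ψ∈Ψ₁} I₂⁻(ψ) = [u008: τ(χ)Σ_{ψ∈Ψ₁}χ(p_ψ)(p_ψt₀)^{−β₃}∫_{𝔍(−1)}… + o(𝔓)]
= [u009: τ(χ)Σ_{p∼P}χ(p)(pt₀)^{−β₃}Σ*_{ψ (mod p)}∫_{(−1/2)}… + o(𝔓)]`, and by u012 each
`Σ*_{ψ (mod p)}∫_{(−1/2)}… ≪ PD^{−4/5}`, so with `|τ(χ)| = √D`, `|χ(p)(pt₀)^{−β₃}| ≤ 1` and
`#{p∼P}·P ≤ 𝔓` the main term is `≪ D^{1/2−4/5}𝔓 = o(𝔓)`.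
[cite: Zhang2022LandauSiegel, §15 (15.4) pp. 80–81] -/
theorem eq15_4_of (c' : ℝ) (h8 : Step15_u008 c') (h9 : Step15_u009 c') (h12 : Step15_u012 c') :
    Eq15_4 c' := by
  intro ε hε
  have hε3 : 0 < ε / 3 := by positivity
  obtain ⟨D₈, hD₈⟩ := h8 (ε / 3) hε3
  obtain ⟨D₉, hD₉⟩ := h9 (ε / 3) hε3
  obtain ⟨C, D₂, hD₂⟩ := h12
  set C₀ : ℝ := max C 0 with hC₀
  have hC₀0 : 0 ≤ C₀ := le_max_right _ _
  have hCC₀ : C ≤ C₀ := le_max_left _ _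
  -- `C₀ D^{−3/10} ≤ ε/3` eventually
  obtain ⟨D₃, hD₃⟩ : ∃ D₃ : ℕ, ∀ D : ℕ, D₃ ≤ D → C₀ * (D : ℝ) ^ (-(3 / 10 : ℝ)) ≤ ε / 3 := by
    obtain ⟨N, hN⟩ := exists_nat_gt ((3 * C₀ / ε) ^ (10 / 3 : ℝ))
    refine ⟨max N 1, fun D hD => ?_⟩
    have hD1 : (1 : ℝ) ≤ D := by exact_mod_cast le_trans (le_max_right _ _) hD
    have hD0 : (0 : ℝ) < D := by linarith
    have hND : (3 * C₀ / ε) ^ (10 / 3 : ℝ) < D :=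
      lt_of_lt_of_le hN (by exact_mod_cast le_trans (le_max_left _ _) hD)
    have hq : 0 ≤ 3 * C₀ / ε := by positivity
    have hpow : 3 * C₀ / ε ≤ (D : ℝ) ^ (3 / 10 : ℝ) := by
      have := Real.rpow_le_rpow (by positivity) hND.le (by norm_num : (0 : ℝ) ≤ 3 / 10)
      rwa [← Real.rpow_mul hq, show (10 / 3 : ℝ) * (3 / 10) = 1 by norm_num, Real.rpow_one] at this
    have hDpos : 0 < (D : ℝ) ^ (3 / 10 : ℝ) := Real.rpow_pos_of_pos hD0 _
    rw [Real.rpow_neg hD0.le, ← div_eq_mul_inv, div_le_iff₀ hDpos]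
    have := (div_le_iff₀ hε).mp hpow
    linarith
  refine ⟨max (max D₈ D₉) (max D₂ (max D₃ 2)), fun D _ χ hD hq hp hA => ?_⟩
  have hD8 : D₈ ≤ D := le_trans (le_trans (le_max_left _ _) (le_max_left _ _)) hD
  have hD9 : D₉ ≤ D := le_trans (le_trans (le_max_right _ _) (le_max_left _ _)) hD
  have hD2' : D₂ ≤ D := le_trans (le_trans (le_max_left _ _) (le_max_right _ _)) hD
  have hD3' : D₃ ≤ D :=
    le_trans (le_trans (le_trans (le_max_left _ _) (le_max_right _ _)) (le_max_right _ _)) hD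
  have hDge2 : 2 ≤ D :=
    le_trans (le_trans (le_trans (le_max_right _ _) (le_max_right _ _)) (le_max_right _ _)) hD
  have b8 := hD₈ D χ hD8 hq hp hA
  have b9 := hD₉ D χ hD9 hq hp hA
  have b12 := hD₂ D χ hD2' hq hp
  have b3 := hD₃ D hD3'
  have hℓ : 0 < ell D := by
    rw [ell]; exact Real.log_pos (by exact_mod_cast (show 1 < D by omega))
  have ht0 : 0 < t0 D := by rw [t0]; positivity
  have hD0 : (0 : ℝ) < D := by exact_mod_cast (show 0 < D by omega)
  have hP0 : 0 < bigP D := Real.exp_pos _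
  -- the three aggregates
  set S : ℂ := ∑ x ∈ finsetOf (PsiOne χ), I2pm c' χ x (-alpha D) with hS
  set T : ℂ := GammaFactor.tau χ * ∑ x ∈ finsetOf (PsiOne χ),
      χ (x.p : ZMod D) * (((x.p : ℝ) * t0 D : ℝ) : ℂ) ^ (-beta3 c' D) *
        Lemma81.segInt (t0 D) (ell1 D) (-1) (fun s =>
          ktildeSeries c' x s * Bpoly χ x s * omegaW D s) with hT
  set M : ℂ := GammaFactor.tau χ * ∑ᶠ x : Chr D,
      χ (x.p : ZMod D) * (((x.p : ℝ) * t0 D : ℝ) : ℂ) ^ (-beta3 c' D) *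
        ((1 / (2 * π) : ℂ) * ∫ t : ℝ, ktildeSeries c' x (-1 / 2 + t * I) *
          Bpoly χ x (-1 / 2 + t * I) * omegaW D (-1 / 2 + t * I)) with hM
  have b8' : ‖S - T‖ ≤ ε / 3 * frakP D := b8
  have b9' : ‖T - M‖ ≤ ε / 3 * frakP D := b9
  -- the main term `M ≪ D^{1/2 − 4/5}𝔓`
  have hτ : ‖GammaFactor.tau χ‖ = Real.sqrt D := by
    rw [GammaFactor.tau, ← Real.sqrt_sq (norm_nonneg _),
      Literature.NumberTheory.Sieve.LargeSieve.norm_gaussSum_sq hp]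
  have hwin : ‖∑ᶠ x : Chr D,
      χ (x.p : ZMod D) * (((x.p : ℝ) * t0 D : ℝ) : ℂ) ^ (-beta3 c' D) *
        ((1 / (2 * π) : ℂ) * ∫ t : ℝ, ktildeSeries c' x (-1 / 2 + t * I) *
          Bpoly χ x (-1 / 2 + t * I) * omegaW D (-1 / 2 + t * I))‖ ≤
      (primeWindow D).card * (C₀ * bigP D * (D : ℝ) ^ (-(4 / 5 : ℝ))) :=
    norm_finsum_chr_window_le
      (fun p : ℕ => χ (p : ZMod D) * (((p : ℝ) * t0 D : ℝ) : ℂ) ^ (-beta3 c' D))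
      (fun x : Chr D => (1 / (2 * π) : ℂ) * ∫ t : ℝ, ktildeSeries c' x (-1 / 2 + t * I) *
          Bpoly χ x (-1 / 2 + t * I) * omegaW D (-1 / 2 + t * I))
      (fun p hpW => by
        have hp0 : 0 < p := (Finset.mem_filter.mp hpW).2.pos
        rw [norm_mul, norm_mul_t0_cpow_neg_beta3 c' hp0 ht0, mul_one]
        exact DirichletCharacter.norm_le_one χ _)
      (fun p hpW => le_trans (b12 p hpW) (by
        have h45 : 0 ≤ (D : ℝ) ^ (-(4 / 5 : ℝ)) := Real.rpow_nonneg hD0.le _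
        have := mul_le_mul_of_nonneg_right (mul_le_mul_of_nonneg_right hCC₀ hP0.le) h45
        exact this))
  have hsq : Real.sqrt (D : ℝ) * (D : ℝ) ^ (-(4 / 5 : ℝ)) = (D : ℝ) ^ (-(3 / 10 : ℝ)) := by
    rw [Real.sqrt_eq_rpow, ← Real.rpow_add hD0]
    norm_num
  have hcardP : 0 ≤ ((primeWindow D).card : ℝ) * bigP D := mul_nonneg (Nat.cast_nonneg _) hP0.le
  have hMle : ‖M‖ ≤ ε / 3 * frakP D := by
    rw [hM, norm_mul, hτ]
    calc Real.sqrt D * ‖∑ᶠ x : Chr D,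
          χ (x.p : ZMod D) * (((x.p : ℝ) * t0 D : ℝ) : ℂ) ^ (-beta3 c' D) *
            ((1 / (2 * π) : ℂ) * ∫ t : ℝ, ktildeSeries c' x (-1 / 2 + t * I) *
              Bpoly χ x (-1 / 2 + t * I) * omegaW D (-1 / 2 + t * I))‖
        ≤ Real.sqrt D * ((primeWindow D).card * (C₀ * bigP D * (D : ℝ) ^ (-(4 / 5 : ℝ)))) :=
          mul_le_mul_of_nonneg_left hwin (Real.sqrt_nonneg _)
      _ = C₀ * (Real.sqrt (D : ℝ) * (D : ℝ) ^ (-(4 / 5 : ℝ))) *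
            (((primeWindow D).card : ℝ) * bigP D) := by ring
      _ = C₀ * (D : ℝ) ^ (-(3 / 10 : ℝ)) * (((primeWindow D).card : ℝ) * bigP D) := by rw [hsq]
      _ ≤ ε / 3 * frakP D :=
          mul_le_mul b3 (Section7bStatements.card_mul_bigP_le_frakP D) hcardP hε3.le
  calc ‖S‖ = ‖(S - T) + (T - M) + M‖ := by congr 1; ring
    _ ≤ ‖S - T‖ + ‖T - M‖ + ‖M‖ := norm_add₃_le
    _ ≤ ε / 3 * frakP D + ε / 3 * frakP D + ε / 3 * frakP D := by linarith
    _ = ε * frakP D := by ring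

end Edge154

/-! ## `Z22:§15.u007`: `k̃ ≪ τ₄` and the `ψ̄`-Dirichlet series of `L·L·K/L` at `1 − s`

For `σ < 0` the point `w = 1 − s` has `Re w > 1`, where `L(w−β₁,ψ̄)`, `L(w−β₂,ψ̄)`, `1/L(w,ψ̄)` are
absolutely convergent `ψ̄`-twisted Dirichlet series (`β_j ∈ iℝ`) and `K(w−β₃,ψ̄)` is the finite
series `Σ g̃₃(n)ψ̄(n)n^{−w}` (`§15.u015`); the product is the series of `ψ̄·(κ₁(−β₁,−β₂) ∗ g̃₃) =
ψ̄·k̃` (the tree's `MeanSquareMajorant.LSeries_twist_conv_kappa₁`), and `|k̃| ≤ τ₃ ∗ τ₁ = τ₄`. -/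

section U007

/-- Termwise majorants multiply under Dirichlet convolution. [folklore] -/
private theorem norm_mul_apply_le' {f g : ArithmeticFunction ℂ} {F G : ArithmeticFunction ℝ}
    (hf : ∀ n, ‖f n‖ ≤ F n) (hg : ∀ n, ‖g n‖ ≤ G n) (n : ℕ) : ‖(f * g) n‖ ≤ (F * G) n := by
  rw [ArithmeticFunction.mul_apply, ArithmeticFunction.mul_apply]
  refine (norm_sum_le _ _).trans (Finset.sum_le_sum fun x _ => ?_)
  rw [norm_mul]
  exact mul_le_mul (hf _) (hg _) (norm_nonneg _) ((norm_nonneg _).trans (hf _))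

/-- `|n^{−ib}| ≤ ζ(n)` (`= 1` for `n ≥ 1`, `0` at `0`). [folklore] -/
private theorem norm_powI_le_zeta' (b : ℝ) (n : ℕ) :
    ‖MeanSquareMajorant.powI b n‖ ≤ (ArithmeticFunction.zeta : ArithmeticFunction ℝ) n := by
  rcases Nat.eq_zero_or_pos n with rfl | hn
  · simp
  · rw [MeanSquareMajorant.norm_powI_of_pos b hn, ArithmeticFunction.natCoe_apply,
      ArithmeticFunction.zeta_apply_ne hn.ne']
    simp

/-- `|μ(n)| ≤ ζ(n)`. [folklore] -/
private theorem norm_moebius_le_zeta' (n : ℕ) :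
    ‖(ArithmeticFunction.moebius : ArithmeticFunction ℂ) n‖ ≤
      (ArithmeticFunction.zeta : ArithmeticFunction ℝ) n := by
  rcases Nat.eq_zero_or_pos n with rfl | hn
  · simp
  · rw [ArithmeticFunction.intCoe_apply, ArithmeticFunction.natCoe_apply,
      ArithmeticFunction.zeta_apply_ne hn.ne', Complex.norm_intCast]
    exact_mod_cast ArithmeticFunction.abs_moebius_le_one



/-- `|κ₁(b₁,b₂)(n)| ≤ τ₃(n)` for all real `b₁, b₂` (`κ₁ = n^{−ib₁} ∗ n^{−ib₂} ∗ μ`, each factor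
bounded by `ζ` termwise). [cite: Zhang2022LandauSiegel, §15 p. 81] -/
theorem norm_kappa₁_le_tau3 (b₁ b₂ : ℝ) (n : ℕ) :
    ‖MeanSquareMajorant.kappa₁ b₁ b₂ n‖ ≤ MeanSquareMajorant.tau 3 n := by
  have h : MeanSquareMajorant.tau 3 =
      ((ArithmeticFunction.zeta : ArithmeticFunction ℝ) * ArithmeticFunction.zeta) *
        ArithmeticFunction.zeta := by
    rw [MeanSquareMajorant.tau, pow_succ, pow_two]
  rw [h, MeanSquareMajorant.kappa₁]
  exact norm_mul_apply_le' (norm_mul_apply_le' (norm_powI_le_zeta' _) (norm_powI_le_zeta' _))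
    norm_moebius_le_zeta' n

/-- **`k̃(m) ≪ τ₄(m)`** (p. 80), in fact `|k̃(m)| ≤ τ₄(m)` once `𝓛 > 0`: `k̃ = κ₁(−β₁,−β₂) ∗ g̃₃`
with `|κ₁| ≤ τ₃` and `|g̃₃| ≤ 1 = τ₁` (`norm_gtilde3_le`). [cite: Zhang2022LandauSiegel, §15 p. 80] -/
theorem norm_ktilde_le (c' : ℝ) {D : ℕ} (hℓ : 0 < ell D) (m : ℕ) :
    ‖ktilde c' D m‖ ≤ MeanSquareMajorant.tau 4 m := by
  have h := MeanSquareMajorant.norm_seqConv_le_tau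
    (u := fun n => MeanSquareMajorant.kappa₁ (-b1 c' D) (-b2 c' D) n)
    (v := fun n : ℕ => gtilde3 c' D n) (C₁ := 1) (C₂ := 1) (j₁ := 3) (j₂ := 1) zero_le_one
    (fun n _ => by rw [one_mul]; exact norm_kappa₁_le_tau3 _ _ n)
    (fun n hn => by
      rw [one_mul, MeanSquareMajorant.tau_one_apply hn]; exact norm_gtilde3_le c' hℓ n) m
  rw [one_mul, one_mul] at h
  exact h

open scoped LSeries.notation in
/-- **`Z22:§15.u007` DISCHARGED** (with `C = 1`, `D ≥ 2`): `|k̃(m)| ≤ τ₄(m)`, and for `σ < 0`,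
`L(1−s−β₁,ψ̄)L(1−s−β₂,ψ̄)K(1−s−β₃,ψ̄)/L(1−s,ψ̄) = Σ_m k̃(m)ψ̄(m)m^{s−1}` (absolutely convergent
Dirichlet series at `w = 1 − s`, `Re w > 1`). [cite: Zhang2022LandauSiegel, §15 p. 80] -/
theorem step15_u007_holds (c' : ℝ) : Step15_u007 c' := by
  refine ⟨1, 2, fun D _ χ hD _ _ => ⟨fun m => ?_, fun x s hs => ?_⟩⟩
  · have hℓ : 0 < ell D := by
      rw [ell]; exact Real.log_pos (by exact_mod_cast (show 1 < D by omega))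
    rw [one_mul]
    exact norm_ktilde_le c' hℓ m
  · haveI : Fact (1 < x.p) := ⟨x.prime.one_lt⟩
    set ψ' : DirichletCharacter ℂ x.p := x.ψ⁻¹ with hψ'
    have hw : 1 < (1 - s).re := by simp only [sub_re, one_re]; linarith
    have hψ0 : ψ' ((0 : ℕ) : ZMod x.p) = 0 := by rw [Nat.cast_zero, MulChar.map_zero]
    have hconj : ∀ n : ℕ, conj (x.ψ (n : ZMod x.p)) = ψ' (n : ZMod x.p) := fun n =>
      (PrimChar.inv_apply_eq_conj x.ψ _).symm
    -- summability of the finitely supported `ψ̄ · g̃₃`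
    have h0 : (↗ψ' * fun n : ℕ => gtilde3 c' D n) 0 = 0 := by rw [Pi.mul_apply, hψ0, zero_mul]
    have hb : LSeriesSummable (↗ψ' * fun n : ℕ => gtilde3 c' D n) (1 - s) := by
      refine summable_of_ne_finset_zero (s := Finset.range (⌈2 * P4 D⌉₊ + 1)) fun n hn => ?_
      rw [Finset.mem_range, not_lt] at hn
      have hn' : 2 * P4 D < n := by
        calc 2 * P4 D ≤ ⌈2 * P4 D⌉₊ := Nat.le_ceil _
          _ < n := by exact_mod_cast (show ⌈2 * P4 D⌉₊ < n by omega)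
      rw [LSeries.term_def₀ h0, Pi.mul_apply, gtilde3_eq_zero c' hn']
      simp
    -- `K(1−s−β₃,ψ̄)` is the `L`-series of `ψ̄ · g̃₃` (`§15.u015`)
    have hK : Kchar D (psiBarFn x) (1 - s - beta3 c' D) =
        L (↗ψ' * fun n : ℕ => gtilde3 c' D n) (1 - s) := by
      rw [step15_u015_holds c' D x s, LSeries]
      refine tsum_congr fun n => ?_
      rw [LSeries.term_def₀ h0, Pi.mul_apply, hconj n, div_eq_mul_inv, cpow_neg]
      ring
    have key := MeanSquareMajorant.LSeries_twist_conv_kappa₁ (-b1 c' D) (-b2 c' D) ψ' hw hb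
    -- the right side of u007 is the `L`-series of `ψ̄ · k̃`
    have hc0 : (↗ψ' * MeanSquareMajorant.conv (MeanSquareMajorant.kappa₁ (-b1 c' D) (-b2 c' D))
        (fun n : ℕ => gtilde3 c' D n)) 0 = 0 := by rw [Pi.mul_apply, hψ0, zero_mul]
    have hR : (∑' m : ℕ, ktilde c' D m * conj (x.ψ (m : ZMod x.p)) / (m : ℂ) ^ (1 - s)) =
        L (↗ψ' * MeanSquareMajorant.conv (MeanSquareMajorant.kappa₁ (-b1 c' D) (-b2 c' D))
          (fun n : ℕ => gtilde3 c' D n)) (1 - s) := by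
      rw [LSeries]
      refine tsum_congr fun m => ?_
      rw [LSeries.term_def₀ hc0, Pi.mul_apply, ktilde, hconj m, div_eq_mul_inv, cpow_neg]
      ring
    have hβ₁ : beta1 c' D = (b1 c' D : ℂ) * I := by simp only [beta1, b1]; push_cast; ring
    have hβ₂ : beta2 c' D = (b2 c' D : ℂ) * I := by simp only [beta2, b2]; push_cast; ring
    have e1 : 1 - s - beta1 c' D = 1 - s + ((-b1 c' D : ℝ) : ℂ) * I := by
      rw [hβ₁]; push_cast; ring
    have e2 : 1 - s - beta2 c' D = 1 - s + ((-b2 c' D : ℝ) : ℂ) * I := by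
      rw [hβ₂]; push_cast; ring
    have hre1 : 1 < (1 - s + ((-b1 c' D : ℝ) : ℂ) * I).re := by
      rw [MeanSquareMajorant.add_mul_I_re]; exact hw
    have hre2 : 1 < (1 - s + ((-b2 c' D : ℝ) : ℂ) * I).re := by
      rw [MeanSquareMajorant.add_mul_I_re]; exact hw
    rw [hR, key, hK, e1, e2, DirichletCharacter.LFunction_eq_LSeries _ hw,
      DirichletCharacter.LFunction_eq_LSeries _ hre1, DirichletCharacter.LFunction_eq_LSeries _ hre2]
    ring

end U007

/-! ## `Z22:(15.8)`: the Mellin step for the innermost sum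

`Σ_{(l₁,d₂k)=1} κ₁(d₁l₁)χ(l₁)Δ(l₁l₂/(Dpk)) = (1/2πi)∫_{(2)} (Σ_{(l₁,d₂k)=1} κ₁(d₁l₁)χ(l₁)l₁^{−s})
(Dpk/l₂)^s δ(s) ds`: Mellin inversion `Δ(x) = (1/2πi)∫_{(2)} x^{−s}δ(s)ds` (vertical integrability on
`σ = 2` from Lemma 5.4 (i), `|δ(s)| ≪ |s|⁻²`), and the interchange of `Σ_{l₁}` with `∫_{(2)}`
(dominated: `|κ₁(d₁l₁)| ≤ τ₃(d₁l₁)`, `Σ τ₃(n)n⁻² < ∞` by the divisor bound, `∫|δ(2+it)|dt < ∞`). -/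

section Eq158

open MeasureTheory

/-- `L₀ ≤ log D` once `D ≥ 3 ≥ e`: `1 ≤ 𝓛`. [folklore] -/
private theorem one_le_ell_of_three_le {D : ℕ} (hD : 3 ≤ D) : 1 ≤ ell D := by
  rw [ell, Real.le_log_iff_exp_le (by exact_mod_cast (show 0 < D by omega))]
  have h3 : (3 : ℝ) ≤ D := by exact_mod_cast hD
  linarith [Real.exp_one_lt_d9]

/-- **`Σ_n τ₃(n)/n² < ∞`** (the divisor bound `τ₂(n) ≤ Cn^{1/4}` gives `τ₃ = τ₂ ∗ 1 ≤ τ₂·τ₂ ≤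
C²n^{1/2}`). [cite: HardyWright2008, Theorem 315] -/
theorem summable_tau_three_div_sq :
    Summable fun n : ℕ => MeanSquareMajorant.tau 3 n / (n : ℝ) ^ 2 := by
  obtain ⟨C, hC1, hC⟩ :=
    Literature.NumberTheory.Sieve.exists_card_divisors_le_mul_rpow' (by norm_num : (0 : ℝ) < 1 / 4)
  have hC0 : 0 ≤ C := by linarith
  have hbound : ∀ n : ℕ,
      MeanSquareMajorant.tau 3 n / (n : ℝ) ^ 2 ≤ C ^ 2 * (n : ℝ) ^ (-(3 / 2 : ℝ)) := by
    intro n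
    rcases Nat.eq_zero_or_pos n with rfl | hn
    · simp [Real.zero_rpow (by norm_num : (-(3 / 2 : ℝ)) ≠ 0)]
    · have hn' : (0 : ℝ) < n := by exact_mod_cast hn
      have h32 : MeanSquareMajorant.tau 3 n = ∑ d ∈ n.divisors, MeanSquareMajorant.tau 2 d :=
        MeanSquareMajorant.tau_succ_apply 2 n
      have h3 : MeanSquareMajorant.tau 3 n ≤ C ^ 2 * (n : ℝ) ^ (1 / 2 : ℝ) := by
        rw [h32]
        calc ∑ d ∈ n.divisors, MeanSquareMajorant.tau 2 d
            ≤ ∑ d ∈ n.divisors, C * (n : ℝ) ^ (1 / 4 : ℝ) := Finset.sum_le_sum fun d hd => by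
                rw [MeanSquareMajorant.tau_two_apply]
                have hdn : d ≤ n := Nat.divisor_le hd
                calc (d.divisors.card : ℝ) ≤ C * (d : ℝ) ^ (1 / 4 : ℝ) := hC d
                  _ ≤ C * (n : ℝ) ^ (1 / 4 : ℝ) :=
                      mul_le_mul_of_nonneg_left (Real.rpow_le_rpow (Nat.cast_nonneg _)
                        (by exact_mod_cast hdn) (by norm_num)) hC0
          _ = (n.divisors.card : ℝ) * (C * (n : ℝ) ^ (1 / 4 : ℝ)) := by
                rw [Finset.sum_const, nsmul_eq_mul]
          _ ≤ (C * (n : ℝ) ^ (1 / 4 : ℝ)) * (C * (n : ℝ) ^ (1 / 4 : ℝ)) :=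
                mul_le_mul_of_nonneg_right (hC n) (by positivity)
          _ = C ^ 2 * ((n : ℝ) ^ (1 / 4 : ℝ) * (n : ℝ) ^ (1 / 4 : ℝ)) := by ring
          _ = C ^ 2 * (n : ℝ) ^ (1 / 2 : ℝ) := by rw [← Real.rpow_add hn']; norm_num
      rw [div_le_iff₀ (by positivity)]
      calc MeanSquareMajorant.tau 3 n ≤ C ^ 2 * (n : ℝ) ^ (1 / 2 : ℝ) := h3
        _ = C ^ 2 * (n : ℝ) ^ (-(3 / 2) : ℝ) * (n : ℝ) ^ 2 := by
            rw [mul_assoc, ← Real.rpow_natCast (n : ℝ) 2, ← Real.rpow_add hn']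
            norm_num
  refine Summable.of_nonneg_of_le
    (fun n => div_nonneg (MeanSquareMajorant.tau_nonneg _ _) (sq_nonneg _)) hbound ?_
  exact (Real.summable_nat_rpow.mpr (by norm_num : (-(3 / 2 : ℝ)) < -1)).mul_left (C ^ 2)

/-- **`t ↦ δ(2+it)` is continuous** (`D ≥ 3`, so `𝓛₂ ≥ 1`; holomorphy of `δ` on `Re s > 0`).
[cite: Zhang2022LandauSiegel, §5 (5.14)] -/
theorem continuous_deltaW_line_two {D : ℕ} (hD : 3 ≤ D) :
    Continuous fun t : ℝ => deltaW D (2 + t * I) := by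
  have hL : 1 ≤ ell2 D := by rw [ell2]; exact one_le_pow₀ (one_le_ell_of_three_le hD)
  have h := Lemma53.continuous_delta514_line hL (t0 D) (σ := 2) two_pos
  simp only [Complex.ofReal_ofNat] at h
  exact h

/-- **`t ↦ δ(2+it)` is integrable on `ℝ`** (`D ≥ 3`): Lemma 5.4 (i) in the explicit form
`|δ(s)| ≤ K/|s|²` on `1/2 ≤ σ ≤ 2` (`Lemma53.norm_delta514_le_explicit`) and `∫(1+t²)⁻¹dt < ∞`.
[cite: Zhang2022LandauSiegel, §5 Lemma 5.4 (i)] -/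
theorem integrable_deltaW_line_two {D : ℕ} (hD : 3 ≤ D) :
    Integrable fun t : ℝ => deltaW D (2 + t * I) := by
  have hℓ1 : 1 ≤ ell D := one_le_ell_of_three_le hD
  have hL : 1 ≤ ell2 D := by rw [ell2]; exact one_le_pow₀ hℓ1
  have ht01 : 1 ≤ t0 D := by rw [t0]; exact one_le_pow₀ hℓ1
  have hJ0 : 0 ≤ Lemma53.Jconst 1 2 := Lemma53.Jconst_nonneg' 1 2
  set A : ℝ := (2 + Real.exp 1) * (4 * π) ^ 2 * Real.exp (((5 : ℕ) : ℝ) ^ 2) +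
      (Real.exp 1 * ((2 * 5).factorial : ℝ) + 5 ^ 5) * Lemma53.Jconst 1 2 with hA
  have hA0 : 0 ≤ A := by positivity
  set K : ℝ := 2 * Lemma53.Jconst 1 2 + 2 * (A * (ell2 D ^ (2 * 5) + t0 D ^ (2 * 5))) with hK
  have hK0 : 0 ≤ K := by
    have h1 : 0 ≤ ell2 D ^ (2 * 5) + t0 D ^ (2 * 5) :=
      add_nonneg (pow_nonneg (by linarith) _) (pow_nonneg (by linarith) _)
    have h2 := mul_nonneg hA0 h1
    linarith
  refine Integrable.mono' (integrable_inv_one_add_sq.const_mul K)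
    (continuous_deltaW_line_two hD).aestronglyMeasurable (Filter.Eventually.of_forall fun t => ?_)
  have h := Lemma53.norm_delta514_le_explicit hL ht01 (s := 2 + t * I) (by norm_num) (by norm_num)
  have hns : ‖(2 : ℂ) + t * I‖ ^ 2 = 4 + t ^ 2 := by
    rw [Complex.sq_norm, Complex.normSq_apply]; simp; ring
  have h4 : 1 + t ^ 2 ≤ 4 + t ^ 2 := by linarith
  calc ‖deltaW D (2 + t * I)‖ = ‖Lemma53.delta514 (ell2 D) (t0 D) (2 + t * I)‖ := rfl
    _ ≤ K / ‖(2 : ℂ) + t * I‖ ^ 2 := h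
    _ ≤ K / (1 + t ^ 2) := by
        rw [hns]; exact div_le_div_of_nonneg_left hK0 (by positivity) h4
    _ = K * (1 + t ^ 2)⁻¹ := div_eq_mul_inv _ _

/-- **Mellin inversion for `Δ` on the line `σ = 2`** (`D ≥ 3`): `Δ(x) = (1/2πi)∫_{(2)} x^{−s}δ(s)ds`
for `x > 0` (as `Skeleton.DeltaW_eq_mellinInv` on `σ = 1`, Mathlib's `mellinInv_mellin_eq`).
[cite: Zhang2022LandauSiegel, §5 (5.14); §15 (15.8)] -/
theorem DeltaW_eq_mellinInv_two {D : ℕ} (hD : 3 ≤ D) {x : ℝ} (hx : 0 < x) :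
    DeltaW D x = (1 / (2 * π) : ℂ) * ∫ t : ℝ, (x : ℂ) ^ (-(2 + t * I)) * deltaW D (2 + t * I) := by
  have hL : 1 ≤ ell2 D := by rw [ell2]; exact one_le_pow₀ (one_le_ell_of_three_le hD)
  have hint := integrable_deltaW_line_two hD
  have hmel : mellin (Lemma53.Delta510 (ell2 D) (t0 D)) = deltaW D := by
    funext s; rw [Lemma53.mellin_Delta510_eq]; rfl
  have hV : Complex.VerticalIntegrable (mellin (Lemma53.Delta510 (ell2 D) (t0 D))) 2 := by
    rw [Complex.VerticalIntegrable, hmel]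
    simpa using hint
  have key := mellinInv_mellin_eq 2 (Lemma53.Delta510 (ell2 D) (t0 D)) hx
    (Lemma53.mellinConvergent_Delta510 hL (t0 D) (by simp)) hV
    ((Lemma53.continuous_Delta510 (by linarith) (t0 D)).continuousAt)
  rw [DeltaW, Lemma53.Delta57_eq_Delta510 (by linarith) (t0 D) hx, ← key, mellinInv, hmel,
    Complex.real_smul]
  congr 1
  push_cast
  ring

/-- `(a/X)^{−s} = X^s/a^s` for `a, X > 0` (real bases, complex exponent). [folklore] -/
private theorem cpow_neg_div_eq {a X : ℝ} (ha : 0 < a) (hX : 0 < X) (s : ℂ) :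
    (((a / X : ℝ)) : ℂ) ^ (-s) = (X : ℂ) ^ s / (a : ℂ) ^ s := by
  have elog : ∀ {y : ℝ}, 0 < y → ∀ w : ℂ, (y : ℂ) ^ w = Complex.exp ((Real.log y : ℂ) * w) :=
    fun {y} hy w => by
      rw [Complex.cpow_def_of_ne_zero (Complex.ofReal_ne_zero.mpr hy.ne'), ← Complex.ofReal_log hy.le]
  rw [elog (div_pos ha hX), elog hX, elog ha, Real.log_div ha.ne' hX.ne', ← Complex.exp_sub]
  congr 1
  push_cast
  ring

/-- **`Z22:(15.8)` DISCHARGED** (`D ≥ 3`, all `p ∼ P`, `d₁, d₂, k, l₂ ≥ 1`): the innermost sum of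
`§15.u019` equals `(1/2πi)∫_{(2)} (Σ_{(l₁,d₂k)=1} κ₁(d₁l₁)χ(l₁)l₁^{−s})(Dpk/l₂)^s δ(s) ds` — Mellin
inversion of `Δ` on `σ = 2` termwise, then `Σ_{l₁}∫ = ∫Σ_{l₁}` by dominated convergence
(`Σ_{l₁} |κ₁(d₁l₁)| l₁⁻² (Dpk/l₂)² ∫|δ(2+it)|dt < ∞`). [cite: Zhang2022LandauSiegel, §15 (15.8) p. 82] -/
theorem eq15_8_holds (c' : ℝ) : Eq15_8 c' := by
  refine ⟨3, fun D _ χ hD _ _ => ?_⟩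
  intro p hp d₁ d₂ k l₂ hd₁ hd₂ hk hl₂
  have hp0 : 0 < p := (Finset.mem_filter.mp hp).2.pos
  have hD0 : 0 < D := by omega
  have hDr : (D : ℝ) ≠ 0 := by positivity
  have hpr : (p : ℝ) ≠ 0 := by positivity
  have hkr : (k : ℝ) ≠ 0 := by positivity
  have hl₂r : (l₂ : ℝ) ≠ 0 := by positivity
  set X : ℝ := (D : ℝ) * p * k / l₂ with hX
  have hX0 : 0 < X := by rw [hX]; positivity
  have hδi := integrable_deltaW_line_two hD
  have hδc := continuous_deltaW_line_two hD
  -- the pieces of the integrand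
  set G : ℝ → ℂ := fun t => (X : ℂ) ^ (2 + t * I) * deltaW D (2 + t * I) with hG
  set f : ℕ → ℝ → ℂ := fun l₁ t => if Nat.Coprime l₁ (d₂ * k) then
      kappa1 c' D (d₁ * l₁) * χ (l₁ : ZMod D) / (l₁ : ℂ) ^ (2 + t * I : ℂ) else 0 with hf
  set F : ℕ → ℝ → ℂ := fun l₁ t => f l₁ t * G t with hF
  have hs : Measurable fun t : ℝ => (2 : ℂ) + t * I := by fun_prop
  have hGn : ∀ t : ℝ, ‖G t‖ = X ^ 2 * ‖deltaW D (2 + t * I)‖ := fun t => by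
    simp only [hG]
    rw [norm_mul, Complex.norm_cpow_eq_rpow_re_of_pos hX0]
    simp
  have hκ0 : kappa1 c' D (d₁ * 0) = 0 := by
    rw [mul_zero, kappa1]; exact ArithmeticFunction.map_zero
  have hfn : ∀ (l₁ : ℕ) (t : ℝ), ‖f l₁ t‖ ≤ MeanSquareMajorant.tau 3 (d₁ * l₁) / (l₁ : ℝ) ^ 2 := by
    intro l₁ t
    simp only [hf]
    by_cases hc : Nat.Coprime l₁ (d₂ * k)
    · rw [if_pos hc]
      rcases Nat.eq_zero_or_pos l₁ with rfl | hl₁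
      · rw [hκ0]; simp
      · rw [norm_div, norm_mul, Complex.norm_natCast_cpow_of_pos hl₁]
        simp only [Complex.add_re, Complex.re_ofNat, Complex.mul_re, Complex.ofReal_re,
          Complex.I_re, mul_zero, Complex.ofReal_im, Complex.I_im, mul_one, sub_self, add_zero,
          Real.rpow_two]
        exact div_le_div_of_nonneg_right
          (by
            calc ‖kappa1 c' D (d₁ * l₁)‖ * ‖χ (l₁ : ZMod D)‖
                ≤ MeanSquareMajorant.tau 3 (d₁ * l₁) * 1 :=
                  mul_le_mul (norm_kappa1_le_tau c' D _) (DirichletCharacter.norm_le_one χ _)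
                    (norm_nonneg _) (MeanSquareMajorant.tau_nonneg _ _)
              _ = MeanSquareMajorant.tau 3 (d₁ * l₁) := mul_one _)
          (sq_nonneg _)
    · rw [if_neg hc, norm_zero]
      exact div_nonneg (MeanSquareMajorant.tau_nonneg _ _) (sq_nonneg _)
  -- each term is integrable in `t`
  have hFm : ∀ l₁ : ℕ, AEStronglyMeasurable (F l₁) := by
    intro l₁
    have h1 : Measurable fun t : ℝ => f l₁ t := by
      simp only [hf]
      by_cases hc : Nat.Coprime l₁ (d₂ * k)
      · simp only [if_pos hc]
        exact measurable_const.div (measurable_const.pow hs)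
      · simp only [if_neg hc]
        exact measurable_const
    have h2 : Measurable G := by
      simp only [hG]
      exact (measurable_const.pow hs).mul hδc.measurable
    exact (h1.mul h2).aestronglyMeasurable
  have hFn : ∀ (l₁ : ℕ) (t : ℝ), ‖F l₁ t‖ ≤
      MeanSquareMajorant.tau 3 (d₁ * l₁) / (l₁ : ℝ) ^ 2 * X ^ 2 * ‖deltaW D (2 + t * I)‖ := by
    intro l₁ t
    simp only [hF]
    rw [norm_mul, hGn]
    calc ‖f l₁ t‖ * (X ^ 2 * ‖deltaW D (2 + t * I)‖)
        ≤ MeanSquareMajorant.tau 3 (d₁ * l₁) / (l₁ : ℝ) ^ 2 * (X ^ 2 * ‖deltaW D (2 + t * I)‖) :=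
          mul_le_mul_of_nonneg_right (hfn l₁ t) (by positivity)
      _ = _ := by ring
  have hFi : ∀ l₁ : ℕ, Integrable (F l₁) := fun l₁ =>
    Integrable.mono' (hδi.norm.const_mul (MeanSquareMajorant.tau 3 (d₁ * l₁) / (l₁ : ℝ) ^ 2 * X ^ 2))
      (hFm l₁) (Filter.Eventually.of_forall fun t => hFn l₁ t)
  -- the sum of the `L¹` norms converges
  have hFs : Summable fun l₁ : ℕ => ∫ t : ℝ, ‖F l₁ t‖ := by
    set Iδ : ℝ := ∫ t : ℝ, ‖deltaW D (2 + t * I)‖ with hIδ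
    have h1 : Summable fun l₁ : ℕ =>
        MeanSquareMajorant.tau 3 (d₁ * l₁) / ((d₁ * l₁ : ℕ) : ℝ) ^ 2 :=
      summable_tau_three_div_sq.comp_injective (mul_right_injective₀ hd₁.ne')
    have h2 : ∀ l₁ : ℕ, MeanSquareMajorant.tau 3 (d₁ * l₁) / (l₁ : ℝ) ^ 2 * X ^ 2 * Iδ =
        ((d₁ : ℝ) ^ 2 * X ^ 2 * Iδ) *
          (MeanSquareMajorant.tau 3 (d₁ * l₁) / ((d₁ * l₁ : ℕ) : ℝ) ^ 2) := by
      intro l₁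
      rcases Nat.eq_zero_or_pos l₁ with rfl | hl
      · simp
      · have hl' : (l₁ : ℝ) ≠ 0 := by positivity
        have hd' : (d₁ : ℝ) ≠ 0 := by positivity
        push_cast
        field_simp
    have hmaj : Summable fun l₁ : ℕ =>
        MeanSquareMajorant.tau 3 (d₁ * l₁) / (l₁ : ℝ) ^ 2 * X ^ 2 * Iδ := by
      simp_rw [h2]
      exact h1.mul_left _
    refine Summable.of_nonneg_of_le (fun l₁ => integral_nonneg fun t => norm_nonneg _)
      (fun l₁ => ?_) hmaj
    calc ∫ t : ℝ, ‖F l₁ t‖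
        ≤ ∫ t : ℝ, MeanSquareMajorant.tau 3 (d₁ * l₁) / (l₁ : ℝ) ^ 2 * X ^ 2 *
            ‖deltaW D (2 + t * I)‖ :=
          integral_mono (hFi l₁).norm (hδi.norm.const_mul _) fun t => hFn l₁ t
      _ = MeanSquareMajorant.tau 3 (d₁ * l₁) / (l₁ : ℝ) ^ 2 * X ^ 2 * Iδ := integral_const_mul _ _
  -- termwise: Mellin inversion
  have hterm : ∀ l₁ : ℕ, (if Nat.Coprime l₁ (d₂ * k) then
        kappa1 c' D (d₁ * l₁) * χ (l₁ : ZMod D) *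
          DeltaW D (((l₁ * l₂ : ℕ) : ℝ) / ((D : ℝ) * p * k))
      else 0) = (1 / (2 * π) : ℂ) * ∫ t : ℝ, F l₁ t := by
    intro l₁
    by_cases hc : Nat.Coprime l₁ (d₂ * k)
    · rw [if_pos hc]
      rcases Nat.eq_zero_or_pos l₁ with rfl | hl₁
      · have hF0 : F 0 = fun _ => 0 := by
          funext t; simp only [hF, hf, if_pos hc, hκ0]; simp
        rw [hκ0, hF0]; simp
      · have hx : 0 < ((l₁ * l₂ : ℕ) : ℝ) / ((D : ℝ) * p * k) := by positivity
        have hxX : ((l₁ * l₂ : ℕ) : ℝ) / ((D : ℝ) * p * k) = (l₁ : ℝ) / X := by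
          rw [hX]; push_cast; field_simp
        rw [DeltaW_eq_mellinInv_two hD hx, hxX, ← mul_assoc,
          mul_comm (kappa1 c' D (d₁ * l₁) * χ (l₁ : ZMod D)) (1 / (2 * π) : ℂ), mul_assoc,
          ← integral_const_mul]
        congr 1
        refine integral_congr_ae (Filter.Eventually.of_forall fun t => ?_)
        simp only [hF, hf, hG, if_pos hc]
        rw [cpow_neg_div_eq (by exact_mod_cast hl₁) hX0, Complex.ofReal_natCast]
        ring
    · have hF0 : F l₁ = fun _ => 0 := by
        funext t; simp only [hF, hf, if_neg hc, zero_mul]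
      rw [if_neg hc, hF0]; simp
  -- assemble
  calc (∑' l₁ : ℕ, if Nat.Coprime l₁ (d₂ * k) then
          kappa1 c' D (d₁ * l₁) * χ (l₁ : ZMod D) *
            DeltaW D (((l₁ * l₂ : ℕ) : ℝ) / ((D : ℝ) * p * k)) else 0)
      = ∑' l₁ : ℕ, (1 / (2 * π) : ℂ) * ∫ t : ℝ, F l₁ t := tsum_congr hterm
    _ = (1 / (2 * π) : ℂ) * ∑' l₁ : ℕ, ∫ t : ℝ, F l₁ t := tsum_mul_left
    _ = (1 / (2 * π) : ℂ) * ∫ t : ℝ, ∑' l₁ : ℕ, F l₁ t := by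
        rw [integral_tsum_of_summable_integral_norm hFi hFs]
    _ = (1 / (2 * π) : ℂ) * ∫ t : ℝ,
          (∑' l₁ : ℕ, if Nat.Coprime l₁ (d₂ * k) then
              kappa1 c' D (d₁ * l₁) * χ (l₁ : ZMod D) / (l₁ : ℂ) ^ (2 + t * I : ℂ) else 0) *
            (X : ℂ) ^ (2 + t * I : ℂ) * deltaW D (2 + t * I) := by
        congr 1
        refine integral_congr_ae (Filter.Eventually.of_forall fun t => ?_)
        simp only [hF, hG, hf]
        rw [tsum_mul_right, mul_assoc]

end Eq158

/-! ## `Z22:§15.u019`: the regrouping of `Σ_{(l,k)=1}(κ₁∗b)(dl)χ(l)Δ(l/(Dpk))`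

"This yields `Σ_{(l,k)=1}(κ₁∗b)(dl)χ(l)Δ(l/(Dpk)) = Σ_{d=d₁d₂}Σ_{(l₂,k)=1} b(d₂l₂)χ(l₂)
Σ_{(l₁,d₂k)=1} κ₁(d₁l₁)χ(l₁)Δ(l₁l₂/(Dpk))`" (p. 82): substitute `§15.u018` and rearrange the double
series over `(l₁, l₂)`, first by the product `l = l₁l₂` (the left side), then iteratively (the right
side). The rearrangement is absolutely convergent when `b` has finite support (true for the printed
`b`, (15.2), and for `χ·b`): `|κ₁(d₁l₁)| ≤ τ₃(d₁l₁)`, `|Δ(x)| ≤ C_Δx⁻²` (Mellin inversion on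
`σ = 2`), `Σ τ₃(n)n⁻² < ∞`. The standing hypothesis `dk < 2P₄` forces `D ≥ 3`. -/

section U019

open MeasureTheory

/-- `b(n) = 0` for `n ≥ ⌈P₁⌉²` (both factors of `b` in (12.2) are supported below `⌈P₁⌉`; every `D`).
[cite: Zhang2022LandauSiegel, §15 (15.2) p. 79] -/
theorem bcoef_eq_zero_of_ceil_sq_le {D n : ℕ} (hn : ⌈Skeleton.P1 D⌉₊ ^ 2 ≤ n) :
    bcoef D n = 0 := by
  rw [bcoef]
  refine Finset.sum_eq_zero fun ab hab => ?_
  obtain ⟨hprod, _⟩ := Nat.mem_divisorsAntidiagonal.mp hab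
  by_cases ha : ⌈Skeleton.P1 D⌉₊ ≤ ab.1
  · have h1 : Skeleton.P1 D ≤ ab.1 := Nat.ceil_le.mp ha
    rw [vk1_eq_zero h1, vk2_eq_zero ((P2_le_P1 D).trans h1)]
    split_ifs <;> simp
  · have hb : ⌈Skeleton.P1 D⌉₊ ≤ ab.2 := by
      by_contra hb
      rw [not_le] at ha hb
      have : ab.1 * ab.2 < ⌈Skeleton.P1 D⌉₊ * ⌈Skeleton.P1 D⌉₊ := Nat.mul_lt_mul'' ha hb
      rw [hprod, ← pow_two] at this
      omega
    have h1 : Skeleton.P1 D ≤ ab.2 := Nat.ceil_le.mp hb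
    rw [vk3_eq_zero ((P3_le_P1 D).trans h1), vk2_eq_zero ((P2_le_P1 D).trans h1)]
    simp

/-- **`|Δ(x)| ≤ C_Δ x⁻²` for `x > 0`** (`D ≥ 3`), `C_Δ = (1/2π)∫|δ(2+it)|dt`, from the Mellin
inversion on `σ = 2` (`DeltaW_eq_mellinInv_two`). [cite: Zhang2022LandauSiegel, §5 (5.14), Lemma 5.4 (i)] -/
theorem norm_DeltaW_le_div_sq {D : ℕ} (hD : 3 ≤ D) :
    ∃ C : ℝ, 0 ≤ C ∧ ∀ x : ℝ, 0 < x → ‖DeltaW D x‖ ≤ C / x ^ 2 := by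
  refine ⟨1 / (2 * π) * ∫ t : ℝ, ‖deltaW D (2 + t * I)‖,
    mul_nonneg (by positivity) (integral_nonneg fun t => norm_nonneg _), fun x hx => ?_⟩
  have h1 : ‖(1 / (2 * π) : ℂ)‖ = 1 / (2 * π) := by
    rw [show (1 / (2 * π) : ℂ) = ((1 / (2 * π) : ℝ) : ℂ) by push_cast; rfl, Complex.norm_real,
      Real.norm_of_nonneg (by positivity)]
  have h2 : ∀ t : ℝ, ‖(x : ℂ) ^ (-(2 + t * I)) * deltaW D (2 + t * I)‖ =
      (x ^ 2)⁻¹ * ‖deltaW D (2 + t * I)‖ := by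
    intro t
    rw [norm_mul, Complex.norm_cpow_eq_rpow_re_of_pos hx]
    simp [Real.rpow_neg hx.le]
  rw [DeltaW_eq_mellinInv_two hD hx, norm_mul, h1]
  calc 1 / (2 * π) * ‖∫ t : ℝ, (x : ℂ) ^ (-(2 + t * I)) * deltaW D (2 + t * I)‖
      ≤ 1 / (2 * π) * ∫ t : ℝ, ‖(x : ℂ) ^ (-(2 + t * I)) * deltaW D (2 + t * I)‖ :=
        mul_le_mul_of_nonneg_left (norm_integral_le_integral_norm _) (by positivity)
    _ = 1 / (2 * π) * ∫ t : ℝ, (x ^ 2)⁻¹ * ‖deltaW D (2 + t * I)‖ := by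
        congr 1; exact integral_congr_ae (Filter.Eventually.of_forall h2)
    _ = 1 / (2 * π) * ((x ^ 2)⁻¹ * ∫ t : ℝ, ‖deltaW D (2 + t * I)‖) := by
        rw [integral_const_mul]
    _ = (1 / (2 * π) * ∫ t : ℝ, ‖deltaW D (2 + t * I)‖) / x ^ 2 := by ring

/-- **`2P₄ ≤ 1` when `D ≤ 2`** (`P₄ = PT⁻²t₀`, `t₀ = 𝓛⁵¹⁹`, `𝓛 ≤ log 2 < 0.7`): the standing
hypothesis "`dk < 2P₄`" of §15 pp. 82–83 (`d, k ≥ 1`) forces `D ≥ 3`. [cite: Zhang2022LandauSiegel, §15 p. 82] -/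
theorem three_le_of_one_lt_two_mul_P4 {D : ℕ} (h : 1 < 2 * P4 D) : 3 ≤ D := by
  by_contra hD
  rw [not_le] at hD
  have hℓ0 : 0 ≤ ell D := by rw [ell]; exact Real.log_natCast_nonneg D
  have hℓ : ell D ≤ Real.log 2 := by
    rw [ell]
    rcases Nat.eq_zero_or_pos D with rfl | hD0
    · simp only [Nat.cast_zero, Real.log_zero]; exact Real.log_nonneg one_le_two
    · exact Real.log_le_log (by exact_mod_cast hD0) (by exact_mod_cast (show D ≤ 2 by omega))
  have hl2 : Real.log 2 < 0.6931471808 := Real.log_two_lt_d9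
  have hℓ1 : ell D ≤ 1 := by linarith
  have hP : bigP D ≤ Real.exp 1 := by
    rw [bigP]; exact Real.exp_le_exp.mpr (pow_le_one₀ hℓ0 hℓ1)
  have hT : 1 ≤ bigT D := by rw [bigT]; exact Real.one_le_exp (Real.rpow_nonneg hℓ0 _)
  have ht0' : 0 ≤ t0 D := by rw [t0]; exact pow_nonneg hℓ0 _
  have ht0 : t0 D ≤ (0.6931471808 : ℝ) ^ 7 := by
    rw [t0]
    calc ell D ^ 519 ≤ ell D ^ 7 := pow_le_pow_of_le_one hℓ0 hℓ1 (by norm_num)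
      _ ≤ Real.log 2 ^ 7 := pow_le_pow_left₀ hℓ0 hℓ 7
      _ ≤ 0.6931471808 ^ 7 := pow_le_pow_left₀ (Real.log_nonneg one_le_two) hl2.le 7
  have he : Real.exp 1 < 2.7182818286 := Real.exp_one_lt_d9
  have h7 : (0.6931471808 : ℝ) ^ 7 < 0.077 := by norm_num
  have hP4 : P4 D ≤ Real.exp 1 * 0.6931471808 ^ 7 := by
    rw [P4]
    calc bigP D / bigT D ^ 2 * t0 D ≤ bigP D * t0 D :=
          mul_le_mul_of_nonneg_right (div_le_self (Real.exp_pos _).le (one_le_pow₀ hT)) ht0'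
      _ ≤ Real.exp 1 * 0.6931471808 ^ 7 := mul_le_mul hP ht0 ht0' (Real.exp_pos 1).le
  nlinarith [Real.exp_pos 1]

/-- `Σ_l τ₃(al)/l² < ∞` for `a ≥ 1` (a sub-series of `Σ_n τ₃(n)/n²`, times `a²`).
[cite: HardyWright2008, Theorem 315] -/
private theorem summable_tau_three_mul_div_sq {a : ℕ} (ha : 0 < a) :
    Summable fun l : ℕ => MeanSquareMajorant.tau 3 (a * l) / (l : ℝ) ^ 2 := by
  have h1 : Summable fun l : ℕ => MeanSquareMajorant.tau 3 (a * l) / ((a * l : ℕ) : ℝ) ^ 2 :=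
    summable_tau_three_div_sq.comp_injective (mul_right_injective₀ ha.ne')
  have h2 : ∀ l : ℕ, MeanSquareMajorant.tau 3 (a * l) / (l : ℝ) ^ 2 =
      (a : ℝ) ^ 2 * (MeanSquareMajorant.tau 3 (a * l) / ((a * l : ℕ) : ℝ) ^ 2) := by
    intro l
    rcases Nat.eq_zero_or_pos l with rfl | hl
    · simp
    · have hl' : (l : ℝ) ≠ 0 := by positivity
      have ha' : (a : ℝ) ≠ 0 := by positivity
      push_cast
      field_simp
  simp_rw [h2]
  exact h1.mul_left _

/-- The fibres of `(l₁,l₂) ↦ l₁l₂`: a summable double series vanishing on the axes sums, grouped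
by the product, to its total (`HasSum.tsum_fiberwise`; the fibre over `l ≥ 1` is
`Nat.divisorsAntidiagonal l`, the fibre over `0` carries only zero terms). [folklore] -/
private theorem hasSum_sum_divisorsAntidiagonal {g : ℕ × ℕ → ℂ} (hg : Summable g)
    (h0 : ∀ q : ℕ × ℕ, q.1 = 0 ∨ q.2 = 0 → g q = 0) :
    HasSum (fun l : ℕ => ∑ q ∈ l.divisorsAntidiagonal, g q) (∑' q : ℕ × ℕ, g q) := by
  have h := hg.hasSum.tsum_fiberwise (fun q : ℕ × ℕ => q.1 * q.2)
  have heq : (fun l : ℕ => ∑ q ∈ l.divisorsAntidiagonal, g q) =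
      fun l : ℕ => ∑' b : ((fun q : ℕ × ℕ => q.1 * q.2) ⁻¹' {l}), g b.val := by
    funext l
    rcases eq_or_ne l 0 with rfl | hl
    · rw [Nat.divisorsAntidiagonal_zero, Finset.sum_empty]
      have hz : ∀ b : ((fun q : ℕ × ℕ => q.1 * q.2) ⁻¹' {0}), g b.val = 0 := by
        rintro ⟨⟨a, c⟩, hb⟩
        simp only [Set.mem_preimage, Set.mem_singleton_iff, Nat.mul_eq_zero] at hb
        exact h0 (a, c) hb
      symm
      calc ∑' b : ((fun q : ℕ × ℕ => q.1 * q.2) ⁻¹' {0}), g b.val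
          = ∑' _ : ((fun q : ℕ × ℕ => q.1 * q.2) ⁻¹' {0}), (0 : ℂ) := tsum_congr hz
        _ = 0 := tsum_zero
    · rw [show ((fun q : ℕ × ℕ => q.1 * q.2) ⁻¹' {l}) = ↑(l.divisorsAntidiagonal) by
          ext q; simp [hl], Finset.tsum_subtype']
  rw [heq]
  exact h

/-- **`Z22:§15.u019`** for every FINITELY SUPPORTED coefficient family `b` (with `b(0) = 0`); the
printed `b` ((15.2)) and `χ·b` are such (`step15_u019_lit_holds`, `step15_u019_chi_holds`).
[cite: Zhang2022LandauSiegel, §15 p. 82] -/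
theorem step15_u019_of_support (c' : ℝ) (b : CoefFam)
    (hb0 : ∀ (D : ℕ) (χ : DirichletCharacter ℂ D), b D χ 0 = 0)
    (hb : ∀ (D : ℕ) (χ : DirichletCharacter ℂ D), ∃ N : ℕ, ∀ n : ℕ, N ≤ n → b D χ n = 0) :
    Step15_u019 c' b := by
  intro D _ χ p d k hp hd hk hdk
  have hdk1 : (1 : ℝ) ≤ ((d * k : ℕ) : ℝ) := by
    exact_mod_cast Nat.one_le_iff_ne_zero.mpr (Nat.mul_ne_zero hd.ne' hk.ne')
  have hD : 3 ≤ D := three_le_of_one_lt_two_mul_P4 (lt_of_le_of_lt hdk1 hdk)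
  have hp0 : 0 < p := (Finset.mem_filter.mp hp).2.pos
  have hD0 : 0 < D := by omega
  set R : ℝ := (D : ℝ) * p * k with hR
  have hR0 : 0 < R := by rw [hR]; positivity
  obtain ⟨CΔ, hCΔ0, hCΔ⟩ := norm_DeltaW_le_div_sq hD
  obtain ⟨N, hN⟩ := hb D χ
  -- the double series, one for each factorisation `d = d₁d₂`
  set A : ℕ × ℕ → ℕ → ℂ := fun dd l₁ =>
    if Nat.Coprime l₁ (dd.2 * k) then kappa1 c' D (dd.1 * l₁) * χ (l₁ : ZMod D) else 0 with hA
  set B : ℕ × ℕ → ℕ → ℂ := fun dd l₂ =>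
    if Nat.Coprime l₂ k then b D χ (dd.2 * l₂) * χ (l₂ : ZMod D) else 0 with hB
  set g : ℕ × ℕ → ℕ × ℕ → ℂ := fun dd q =>
    A dd q.1 * B dd q.2 * DeltaW D (((q.1 * q.2 : ℕ) : ℝ) / R) with hg
  have hκ0 : ∀ dd : ℕ × ℕ, kappa1 c' D (dd.1 * 0) = 0 := fun dd => by
    rw [mul_zero, kappa1]; exact ArithmeticFunction.map_zero
  have hA0 : ∀ dd, A dd 0 = 0 := fun dd => by
    simp only [hA]; split_ifs <;> simp
  have hB0 : ∀ dd, B dd 0 = 0 := fun dd => by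
    simp only [hB]; split_ifs <;> simp [hb0]
  have hg0 : ∀ dd (q : ℕ × ℕ), q.1 = 0 ∨ q.2 = 0 → g dd q = 0 := by
    rintro dd ⟨q1, q2⟩ (h | h) <;> simp only at h <;> subst h <;> simp only [hg, hA0, hB0] <;> simp
  have hAn : ∀ dd l₁, ‖A dd l₁‖ ≤ MeanSquareMajorant.tau 3 (dd.1 * l₁) := by
    intro dd l₁
    simp only [hA]
    split_ifs
    · rw [norm_mul]
      calc ‖kappa1 c' D (dd.1 * l₁)‖ * ‖χ (l₁ : ZMod D)‖
          ≤ MeanSquareMajorant.tau 3 (dd.1 * l₁) * 1 :=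
            mul_le_mul (norm_kappa1_le_tau c' D _) (DirichletCharacter.norm_le_one χ _)
              (norm_nonneg _) (MeanSquareMajorant.tau_nonneg _ _)
        _ = _ := mul_one _
    · rw [norm_zero]; exact MeanSquareMajorant.tau_nonneg _ _
  have hBsupp : ∀ dd ∈ d.divisorsAntidiagonal, ∀ l₂ : ℕ, N ≤ l₂ → B dd l₂ = 0 := by
    intro dd hdd l₂ hl₂
    obtain ⟨hprod, hd0⟩ := Nat.mem_divisorsAntidiagonal.mp hdd
    have hd2 : 0 < dd.2 := Nat.pos_of_ne_zero fun h => hd0 (by rw [← hprod, h, mul_zero])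
    have hn : N ≤ dd.2 * l₂ := le_trans hl₂ (Nat.le_mul_of_pos_left l₂ hd2)
    simp only [hB]
    split_ifs <;> simp [hN _ hn]
  have hΔ : ∀ q : ℕ × ℕ, 0 < q.1 → 0 < q.2 →
      ‖DeltaW D (((q.1 * q.2 : ℕ) : ℝ) / R)‖ ≤ CΔ * R ^ 2 / (q.1 : ℝ) ^ 2 := by
    intro q h1 h2
    have hx : (0 : ℝ) < ((q.1 * q.2 : ℕ) : ℝ) / R := by positivity
    have hq1 : (0 : ℝ) < q.1 := by exact_mod_cast h1
    have hq12 : (q.1 : ℝ) ^ 2 ≤ (((q.1 * q.2 : ℕ) : ℝ)) ^ 2 := by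
      push_cast
      exact pow_le_pow_left₀ hq1.le
        (le_mul_of_one_le_right hq1.le (by exact_mod_cast h2)) 2
    calc ‖DeltaW D (((q.1 * q.2 : ℕ) : ℝ) / R)‖ ≤ CΔ / ((((q.1 * q.2 : ℕ) : ℝ)) / R) ^ 2 := hCΔ _ hx
      _ = CΔ * R ^ 2 / (((q.1 * q.2 : ℕ) : ℝ)) ^ 2 := by
          rw [div_pow, div_div_eq_mul_div]
      _ ≤ CΔ * R ^ 2 / (q.1 : ℝ) ^ 2 :=
          div_le_div_of_nonneg_left (by positivity) (by positivity) hq12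
  -- the majorant `v(l₁)·|B(l₂)|`
  have hgn : ∀ dd (q : ℕ × ℕ), ‖g dd q‖ ≤
      MeanSquareMajorant.tau 3 (dd.1 * q.1) / (q.1 : ℝ) ^ 2 * (CΔ * R ^ 2) * ‖B dd q.2‖ := by
    intro dd q
    have hnn : 0 ≤ MeanSquareMajorant.tau 3 (dd.1 * q.1) / (q.1 : ℝ) ^ 2 * (CΔ * R ^ 2) * ‖B dd q.2‖ :=
      mul_nonneg (mul_nonneg (div_nonneg (MeanSquareMajorant.tau_nonneg _ _) (sq_nonneg _))
        (by positivity)) (norm_nonneg _)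
    rcases Nat.eq_zero_or_pos q.1 with h1 | h1
    · rw [hg0 dd q (Or.inl h1), norm_zero]; exact hnn
    rcases Nat.eq_zero_or_pos q.2 with h2 | h2
    · rw [hg0 dd q (Or.inr h2), norm_zero]; exact hnn
    simp only [hg]
    rw [norm_mul, norm_mul]
    have hq1 : (0 : ℝ) < (q.1 : ℝ) ^ 2 := by positivity
    calc ‖A dd q.1‖ * ‖B dd q.2‖ * ‖DeltaW D (((q.1 * q.2 : ℕ) : ℝ) / R)‖
        ≤ MeanSquareMajorant.tau 3 (dd.1 * q.1) * ‖B dd q.2‖ * (CΔ * R ^ 2 / (q.1 : ℝ) ^ 2) :=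
          mul_le_mul (mul_le_mul_of_nonneg_right (hAn dd q.1) (norm_nonneg _)) (hΔ q h1 h2)
            (norm_nonneg _) (mul_nonneg (MeanSquareMajorant.tau_nonneg _ _) (norm_nonneg _))
      _ = _ := by field_simp
  have hv : ∀ dd ∈ d.divisorsAntidiagonal, Summable fun l₁ : ℕ =>
      MeanSquareMajorant.tau 3 (dd.1 * l₁) / (l₁ : ℝ) ^ 2 * (CΔ * R ^ 2) := by
    intro dd hdd
    obtain ⟨hprod, hd0⟩ := Nat.mem_divisorsAntidiagonal.mp hdd
    have hd1 : 0 < dd.1 := Nat.pos_of_ne_zero fun h => hd0 (by rw [← hprod, h, zero_mul])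
    exact (summable_tau_three_mul_div_sq hd1).mul_right _
  have hu : ∀ dd ∈ d.divisorsAntidiagonal, Summable fun l₂ : ℕ => ‖B dd l₂‖ := fun dd hdd =>
    summable_of_ne_finset_zero (s := Finset.range N) fun l₂ hl₂ => by
      rw [Finset.mem_range, not_lt] at hl₂
      rw [hBsupp dd hdd l₂ hl₂, norm_zero]
  -- summability over `ℕ × ℕ` and in `l₁` for fixed `l₂`
  have hgs : ∀ dd ∈ d.divisorsAntidiagonal, Summable (g dd) := fun dd hdd =>
    Summable.of_norm_bounded ((hv dd hdd).mul_of_nonneg (hu dd hdd)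
      (fun l₁ => mul_nonneg (div_nonneg (MeanSquareMajorant.tau_nonneg _ _) (sq_nonneg _))
        (by positivity)) (fun l₂ => norm_nonneg _)) (fun q => hgn dd q)
  have hgs1 : ∀ dd ∈ d.divisorsAntidiagonal, ∀ l₂ : ℕ, Summable fun l₁ : ℕ => g dd (l₁, l₂) :=
    fun dd hdd l₂ => Summable.of_norm_bounded ((hv dd hdd).mul_right ‖B dd l₂‖)
      (fun l₁ => hgn dd (l₁, l₂))
  -- grouped by the product `l = l₁l₂`
  have hfib : ∀ dd ∈ d.divisorsAntidiagonal,
      HasSum (fun l : ℕ => ∑ q ∈ l.divisorsAntidiagonal, g dd q) (∑' q : ℕ × ℕ, g dd q) :=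
    fun dd hdd => hasSum_sum_divisorsAntidiagonal (hgs dd hdd) (hg0 dd)
  -- the left side, term by term (`§15.u018`)
  have hstep1 : ∀ l : ℕ, (if Nat.Coprime l k then
        kappaStar1 c' D (b D χ) (d * l) * χ (l : ZMod D) * DeltaW D ((l : ℝ) / R) else 0) =
      ∑ dd ∈ d.divisorsAntidiagonal, ∑ q ∈ l.divisorsAntidiagonal, g dd q := by
    intro l
    rcases Nat.eq_zero_or_pos l with rfl | hl
    · have h0 : kappaStar1 c' D (b D χ) 0 = 0 := by
        simp only [kappaStar1, MeanSquareMajorant.conv, Nat.divisorsAntidiagonal_zero,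
          Finset.sum_empty]
      simp [h0, Nat.divisorsAntidiagonal_zero]
    · rw [step15_u018_holds c' b D χ d l hd hl]
      by_cases hc : Nat.Coprime l k
      · rw [if_pos hc, Finset.sum_mul, Finset.sum_mul]
        refine Finset.sum_congr rfl fun dd _ => ?_
        rw [Finset.sum_mul, Finset.sum_mul, Finset.sum_filter]
        refine Finset.sum_congr rfl fun q hq => ?_
        obtain ⟨hq1, _⟩ := Nat.mem_divisorsAntidiagonal.mp hq
        have hcl : Nat.Coprime (q.1 * q.2) k := by rw [hq1]; exact hc
        have hc1 : Nat.Coprime q.1 k := Nat.Coprime.coprime_mul_right hcl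
        have hc2 : Nat.Coprime q.2 k := Nat.Coprime.coprime_mul_left hcl
        simp only [hg, hA, hB]
        by_cases hcd : Nat.Coprime q.1 dd.2
        · have hA' : Nat.Coprime q.1 (dd.2 * k) := Nat.Coprime.mul_right hcd hc1
          rw [if_pos hcd, if_pos hA', if_pos hc2, ← hq1]
          push_cast
          rw [map_mul χ]
          ring
        · have hA' : ¬ Nat.Coprime q.1 (dd.2 * k) := fun h =>
            hcd (Nat.Coprime.coprime_mul_right_right h)
          rw [if_neg hcd, if_neg hA']
          simp
      · rw [if_neg hc]
        symm
        refine Finset.sum_eq_zero fun dd _ => Finset.sum_eq_zero fun q hq => ?_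
        obtain ⟨hq1, _⟩ := Nat.mem_divisorsAntidiagonal.mp hq
        simp only [hg, hA, hB]
        by_cases h1 : Nat.Coprime q.1 k
        · have h2 : ¬ Nat.Coprime q.2 k := fun h2 => hc (by rw [← hq1]; exact Nat.Coprime.mul_left h1 h2)
          rw [if_neg h2]
          simp
        · have hA' : ¬ Nat.Coprime q.1 (dd.2 * k) := fun h =>
            h1 (Nat.Coprime.coprime_mul_left_right h)
          rw [if_neg hA']
          simp
  -- assemble
  have hsumm : ∀ dd ∈ d.divisorsAntidiagonal,
      Summable fun l : ℕ => ∑ q ∈ l.divisorsAntidiagonal, g dd q :=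
    fun dd hdd => (hfib dd hdd).summable
  calc (∑' l : ℕ, if Nat.Coprime l k then
          kappaStar1 c' D (b D χ) (d * l) * χ (l : ZMod D) * DeltaW D ((l : ℝ) / R) else 0)
      = ∑' l : ℕ, ∑ dd ∈ d.divisorsAntidiagonal, ∑ q ∈ l.divisorsAntidiagonal, g dd q :=
        tsum_congr hstep1
    _ = ∑ dd ∈ d.divisorsAntidiagonal, ∑' l : ℕ, ∑ q ∈ l.divisorsAntidiagonal, g dd q :=
        Summable.tsum_finsetSum hsumm
    _ = ∑ dd ∈ d.divisorsAntidiagonal, ∑' q : ℕ × ℕ, g dd q :=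
        Finset.sum_congr rfl fun dd hdd => (hfib dd hdd).tsum_eq
    _ = ∑ dd ∈ d.divisorsAntidiagonal, ∑' l₂ : ℕ, ∑' l₁ : ℕ, g dd (l₁, l₂) :=
        Finset.sum_congr rfl fun dd hdd => by
          have e1 := (Equiv.prodComm ℕ ℕ).tsum_eq (g dd)
          simp only [Equiv.prodComm_apply] at e1
          rw [← e1]
          have hs' : Summable fun c : ℕ × ℕ => g dd c.swap :=
            (Equiv.prodComm ℕ ℕ).summable_iff.mpr (hgs dd hdd)
          rw [Summable.tsum_prod' hs' (fun l₂ => by simpa using hgs1 dd hdd l₂)]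
          simp
    _ = ∑ dd ∈ d.divisorsAntidiagonal, ∑' l₂ : ℕ, if Nat.Coprime l₂ k then
          b D χ (dd.2 * l₂) * χ (l₂ : ZMod D) *
            ∑' l₁ : ℕ, (if Nat.Coprime l₁ (dd.2 * k) then
              kappa1 c' D (dd.1 * l₁) * χ (l₁ : ZMod D) *
                DeltaW D (((l₁ * l₂ : ℕ) : ℝ) / R)
            else 0)
        else 0 := by
        refine Finset.sum_congr rfl fun dd _ => tsum_congr fun l₂ => ?_
        have hre : ∀ l₁ : ℕ, g dd (l₁, l₂) =
            B dd l₂ * (A dd l₁ * DeltaW D (((l₁ * l₂ : ℕ) : ℝ) / R)) := fun l₁ => by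
          simp only [hg]; ring
        simp_rw [hre]
        rw [tsum_mul_left]
        simp only [hB, hA]
        by_cases hc2 : Nat.Coprime l₂ k
        · rw [if_pos hc2, if_pos hc2]
          congr 1
          refine tsum_congr fun l₁ => ?_
          split_ifs <;> simp
        · rw [if_neg hc2, if_neg hc2, zero_mul]

/-- `b = bcoef D` vanishes at `0` (the convolution over `Nat.divisorsAntidiagonal 0 = ∅`). [folklore] -/
private theorem bcoef_zero (D : ℕ) : bcoef D 0 = 0 := by
  rw [bcoef, Nat.divisorsAntidiagonal_zero, Finset.sum_empty]

/-- **`Z22:§15.u019` DISCHARGED at the printed `b = bLit`** (the DAG node's instance).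
[cite: Zhang2022LandauSiegel, §15 p. 82] -/
theorem step15_u019_lit_holds (c' : ℝ) : Step15_u019 c' bLit :=
  step15_u019_of_support c' bLit (fun D _ => bcoef_zero D) fun D _ =>
    ⟨⌈Skeleton.P1 D⌉₊ ^ 2, fun _ hn => bcoef_eq_zero_of_ceil_sq_le hn⟩

/-- **`Z22:§15.u019` at the χ-absorbed `b = bChi`** (module note of `TypedSection15A`).
[cite: Zhang2022LandauSiegel, §15 p. 82] -/
theorem step15_u019_chi_holds (c' : ℝ) : Step15_u019 c' bChi :=
  step15_u019_of_support c' bChi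
    (fun D χ => by show bchi χ 0 = 0; rw [bchi, bcoef_zero, mul_zero])
    fun D χ => ⟨⌈Skeleton.P1 D⌉₊ ^ 2, fun n hn => by
      show bchi χ n = 0; rw [bchi, bcoef_eq_zero_of_ceil_sq_le hn, mul_zero]⟩

end U019

/-! ## `Z22:§15.u020`: the splitting `l₁ = hl` and the Euler factor `λ₁`

"Every `l₁` can be uniquely written as `l₁ = hl` such that `h ∈ 𝔫(d₁)` and `(l, d₁) = 1`, so that
`κ₁(d₁l₁) = κ₁(d₁h)κ₁(l)`. Hence, for `σ > 1`, `Σ_{(l₁,d₂k)=1} κ₁(d₁l₁)χ(l₁)l₁^{−s} =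
κ̃₁(d₁;d₂k,s) Σ_{(l,d₁d₂k)=1} κ₁(l)χ(l)l^{−s} = κ̃₁(d₁;d₂k,s)λ₁(d₁d₂k,s)L(s+β₁,χ)L(s+β₂,χ)/L(s,χ)`"
(p. 82). The splitting is the tree's `KappaEuler.exists_split` / `convolution_eq_of_split` (as in
`KappaEuler.split_conv_apply` for §7's `κ`), for the multiplicative `χ·κ₁`; the second equality avoids
Euler products: `χ(l)·𝟙[(l,M)=1]` is the Dirichlet character `χ` viewed at level `DM`
(`DirichletCharacter.changeLevel`), whose twisted series is `L(s+β₁,·)L(s+β₂,·)/L(s,·)`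
(`MeanSquareMajorant.LSeries_twist_kappa₁`), and Mathlib's `DirichletCharacter.LSeries_changeLevel`
supplies the finitely many missing Euler factors `∏_{q∣M}(1 − χ(q)q^{−w})`, i.e. `λ₁`. -/

section U020

open scoped LSeries.notation
open LSeries

/-- **`Σ_n τ₃(n)/n^σ < ∞` for `σ > 1`** (divisor bound with exponent `(σ−1)/4`).
[cite: HardyWright2008, Theorem 315] -/
theorem summable_tau_three_div_rpow {σ : ℝ} (hσ : 1 < σ) :
    Summable fun n : ℕ => MeanSquareMajorant.tau 3 n / (n : ℝ) ^ σ := by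
  set ε : ℝ := (σ - 1) / 4 with hε
  have hε0 : 0 < ε := by rw [hε]; linarith
  obtain ⟨C, hC1, hC⟩ := Literature.NumberTheory.Sieve.exists_card_divisors_le_mul_rpow' hε0
  have hC0 : 0 ≤ C := by linarith
  have hexp : 2 * ε - σ < -1 := by rw [hε]; linarith
  have hbound : ∀ n : ℕ,
      MeanSquareMajorant.tau 3 n / (n : ℝ) ^ σ ≤ C ^ 2 * (n : ℝ) ^ (2 * ε - σ) := by
    intro n
    rcases Nat.eq_zero_or_pos n with rfl | hn
    · simp [Real.zero_rpow (by linarith : (2 * ε - σ) ≠ 0), Real.zero_rpow (by linarith : σ ≠ 0)]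
    · have hn' : (0 : ℝ) < n := by exact_mod_cast hn
      have h32 : MeanSquareMajorant.tau 3 n = ∑ d ∈ n.divisors, MeanSquareMajorant.tau 2 d :=
        MeanSquareMajorant.tau_succ_apply 2 n
      have h3 : MeanSquareMajorant.tau 3 n ≤ C ^ 2 * (n : ℝ) ^ (2 * ε) := by
        rw [h32]
        calc ∑ d ∈ n.divisors, MeanSquareMajorant.tau 2 d
            ≤ ∑ d ∈ n.divisors, C * (n : ℝ) ^ ε := Finset.sum_le_sum fun d hd => by
                rw [MeanSquareMajorant.tau_two_apply]
                have hdn : d ≤ n := Nat.divisor_le hd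
                calc (d.divisors.card : ℝ) ≤ C * (d : ℝ) ^ ε := hC d
                  _ ≤ C * (n : ℝ) ^ ε :=
                      mul_le_mul_of_nonneg_left (Real.rpow_le_rpow (Nat.cast_nonneg _)
                        (by exact_mod_cast hdn) hε0.le) hC0
          _ = (n.divisors.card : ℝ) * (C * (n : ℝ) ^ ε) := by
                rw [Finset.sum_const, nsmul_eq_mul]
          _ ≤ (C * (n : ℝ) ^ ε) * (C * (n : ℝ) ^ ε) :=
                mul_le_mul_of_nonneg_right (hC n) (by positivity)
          _ = C ^ 2 * ((n : ℝ) ^ ε * (n : ℝ) ^ ε) := by ring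
          _ = C ^ 2 * (n : ℝ) ^ (2 * ε) := by rw [← Real.rpow_add hn']; ring_nf
      rw [div_le_iff₀ (by positivity)]
      calc MeanSquareMajorant.tau 3 n ≤ C ^ 2 * (n : ℝ) ^ (2 * ε) := h3
        _ = C ^ 2 * (n : ℝ) ^ (2 * ε - σ) * (n : ℝ) ^ σ := by
            rw [mul_assoc, ← Real.rpow_add hn']; ring_nf
  refine Summable.of_nonneg_of_le
    (fun n => div_nonneg (MeanSquareMajorant.tau_nonneg _ _) (Real.rpow_nonneg (Nat.cast_nonneg _) _))
    hbound ?_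
  exact (Real.summable_nat_rpow.mpr hexp).mul_left (C ^ 2)

/-- `Σ_l τ₃(al)/l^σ < ∞` for `a ≥ 1`, `σ > 1` (a sub-series of `Σ_n τ₃(n)/n^σ`, times `a^σ`).
[cite: HardyWright2008, Theorem 315] -/
private theorem summable_tau_three_mul_div_rpow {a : ℕ} (ha : 0 < a) {σ : ℝ} (hσ : 1 < σ) :
    Summable fun l : ℕ => MeanSquareMajorant.tau 3 (a * l) / (l : ℝ) ^ σ := by
  have h1 : Summable fun l : ℕ => MeanSquareMajorant.tau 3 (a * l) / ((a * l : ℕ) : ℝ) ^ σ :=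
    (summable_tau_three_div_rpow hσ).comp_injective (mul_right_injective₀ ha.ne')
  have h2 : ∀ l : ℕ, MeanSquareMajorant.tau 3 (a * l) / (l : ℝ) ^ σ =
      (a : ℝ) ^ σ * (MeanSquareMajorant.tau 3 (a * l) / ((a * l : ℕ) : ℝ) ^ σ) := by
    intro l
    have ha' : (0 : ℝ) < a := by exact_mod_cast ha
    rcases Nat.eq_zero_or_pos l with rfl | hl
    · simp [Real.zero_rpow (by linarith : σ ≠ 0)]
    · have hl' : (0 : ℝ) < l := by exact_mod_cast hl
      have hapow : (0 : ℝ) < (a : ℝ) ^ σ := Real.rpow_pos_of_pos ha' σ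
      push_cast
      rw [Real.mul_rpow ha'.le hl'.le]
      field_simp
  simp_rw [h2]
  exact h1.mul_left _

/-- Zhang's `𝔫(N)` is Mathlib's set of `N.primeFactors`-factored numbers (`N ≥ 1`; as
`KappaEuler.mem_nset_iff`). [cite: Zhang2022LandauSiegel, §7 p.32] -/
private theorem mem_nset_iff' {N h : ℕ} (hN : N ≠ 0) :
    h ∈ nset N ↔ h ∈ Nat.factoredNumbers N.primeFactors := by
  rw [Nat.mem_factoredNumbers_iff_primeFactors_subset, nset, Set.mem_setOf_eq]
  constructor
  · rintro ⟨hh, hq⟩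
    refine ⟨hh.ne', fun q hqm => ?_⟩
    have hq' := Nat.mem_primeFactors.mp hqm
    exact Nat.mem_primeFactors.mpr ⟨hq'.1, hq q hq'.1 hq'.2.1, hN⟩
  · rintro ⟨hh, hsub⟩
    refine ⟨Nat.pos_of_ne_zero hh, fun q hq hqh => ?_⟩
    exact (Nat.mem_primeFactors.mp (hsub (Nat.mem_primeFactors.mpr ⟨hq, hqh, hh⟩))).2.1

open scoped Classical in
/-- **The splitting `l₁ = hl`** (p. 82): for `l ≥ 1`,
`𝟙[(l,m)=1]κ₁(d₁l)χ(l) = (𝟙[h ∈ 𝔫(d₁), (h,m)=1]κ₁(d₁h)χ(h) ∗ 𝟙[(r,d₁m)=1]κ₁(r)χ(r))(l)` — every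
`l` coprime to `m` is uniquely `hr` with `h ∈ 𝔫(d₁)`, `(h,m)=1`, `(r,d₁m)=1`, and
`κ₁(d₁hr)χ(hr) = κ₁(d₁h)χ(h)·κ₁(r)χ(r)` (the tree's `KappaEuler.exists_split` /
`convolution_eq_of_split`, as in `KappaEuler.split_conv_apply`). [cite: Zhang2022LandauSiegel, §15 p. 82] -/
theorem split_conv_apply_kappa1 (c' : ℝ) {D : ℕ} (χ : DirichletCharacter ℂ D) {d₁ m : ℕ}
    (hd₁ : d₁ ≠ 0) {l : ℕ} (hl : l ≠ 0) :
    ((fun h : ℕ => if h ∈ nset d₁ ∧ Nat.Coprime h m then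
        kappa1 c' D (d₁ * h) * χ (h : ZMod D) else 0) ⍟
      (fun r : ℕ => if Nat.Coprime r (d₁ * m) then kappa1 c' D r * χ (r : ZMod D) else 0)) l =
      if Nat.Coprime l m then kappa1 c' D (d₁ * l) * χ (l : ZMod D) else 0 := by
  obtain ⟨a, b, hab, ha, hb⟩ := KappaEuler.exists_split d₁.primeFactors hl
  have hA : ∀ a, a ∉ Nat.factoredNumbers d₁.primeFactors →
      (fun h : ℕ => if h ∈ nset d₁ ∧ Nat.Coprime h m then
        kappa1 c' D (d₁ * h) * χ (h : ZMod D) else 0) a = 0 := fun a ha => by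
    simp only
    rw [if_neg]
    exact fun h => ha ((mem_nset_iff' hd₁).mp h.1)
  have hB : ∀ b, ∀ q ∈ d₁.primeFactors, q.Prime → q ∣ b →
      (fun r : ℕ => if Nat.Coprime r (d₁ * m) then kappa1 c' D r * χ (r : ZMod D) else 0) b = 0 := by
    intro b q hq hqp hqb
    simp only
    rw [if_neg]
    have hqd : q ∣ d₁ * m := dvd_trans (Nat.dvd_of_mem_primeFactors hq) (dvd_mul_right d₁ m)
    exact Nat.not_coprime_of_dvd_of_dvd hqp.one_lt hqb hqd
  rw [KappaEuler.convolution_eq_of_split hA hB hl hab ha hb]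
  have had : Nat.Coprime b d₁ := KappaEuler.coprime_of_split' hb hd₁ subset_rfl
  have hba : Nat.Coprime b a := KappaEuler.coprime_of_split hb ha
  have ha' : a ∈ nset d₁ := (mem_nset_iff' hd₁).mpr ha
  by_cases hlm : Nat.Coprime l m
  · have ham : Nat.Coprime a m := Nat.Coprime.coprime_dvd_left ⟨b, hab.symm⟩ hlm
    have hbm : Nat.Coprime b m :=
      Nat.Coprime.coprime_dvd_left ⟨a, by rw [mul_comm]; exact hab.symm⟩ hlm
    have hbdm : Nat.Coprime b (d₁ * m) := Nat.Coprime.mul_right had hbm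
    have hcop : Nat.Coprime (d₁ * a) b := Nat.Coprime.mul_left had.symm hba.symm
    rw [if_pos hlm, if_pos ⟨ha', ham⟩, if_pos hbdm, ← hab, show d₁ * (a * b) = (d₁ * a) * b by ring,
      kappa1, (MeanSquareMajorant.isMultiplicative_kappa₁ _ _).map_mul_of_coprime hcop, Nat.cast_mul,
      map_mul χ]
    ring
  · rw [if_neg hlm]
    by_cases ham : Nat.Coprime a m
    · have hbm : ¬ Nat.Coprime b m := fun hbm => hlm (hab ▸ Nat.Coprime.mul_left ham hbm)
      rw [if_neg (fun h : Nat.Coprime b (d₁ * m) => hbm (Nat.Coprime.coprime_mul_left_right h)),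
        mul_zero]
    · rw [if_neg (fun h : a ∈ nset d₁ ∧ Nat.Coprime a m => ham h.2), zero_mul]

/-- **The Euler factor `λ₁`** (p. 82, second equality of `§15.u020`): for `σ > 1` and `M ≥ 1`,
`Σ_{(l,M)=1} κ₁(l)χ(l)l^{−s} = λ₁(M,s)·L(s+β₁,χ)L(s+β₂,χ)/L(s,χ)` — `χ(l)𝟙[(l,M)=1]` is `χ` at level
`DM`; its `κ₁`-twisted series is `L(s+β₁)L(s+β₂)/L(s)` of that character
(`MeanSquareMajorant.LSeries_twist_kappa₁`), and each of these is the corresponding series of `χ`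
times `∏_{q∣M}(1 − χ(q)q^{−w})` (`DirichletCharacter.LSeries_changeLevel`; the primes `q ∣ D`
contribute `1`). [cite: Zhang2022LandauSiegel, §15 p. 82] -/
theorem tsum_coprime_kappa1_chi (c' : ℝ) {D : ℕ} [NeZero D] (χ : DirichletCharacter ℂ D) {M : ℕ}
    (hM : M ≠ 0) {s : ℂ} (hs : 1 < s.re) :
    (∑' l : ℕ, if Nat.Coprime l M then kappa1 c' D l * χ (l : ZMod D) / (l : ℂ) ^ s else 0) =
      lam1 c' χ M s *
        (χ.LFunction (s + beta1 c' D) * χ.LFunction (s + beta2 c' D) / χ.LFunction s) := by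
  have hD0 : D ≠ 0 := NeZero.ne D
  haveI : NeZero (D * M) := ⟨mul_ne_zero hD0 hM⟩
  set ψ : DirichletCharacter ℂ (D * M) := DirichletCharacter.changeLevel (dvd_mul_right D M) χ with hψdef
  -- values of `ψ`
  have hψ : ∀ l : ℕ, ψ (l : ZMod (D * M)) = if Nat.Coprime l (D * M) then χ (l : ZMod D) else 0 := by
    intro l
    by_cases hc : Nat.Coprime l (D * M)
    · have hu : IsUnit (l : ZMod (D * M)) := (ZMod.isUnit_iff_coprime l (D * M)).mpr hc
      rw [if_pos hc, ← hu.unit_spec, hψdef, DirichletCharacter.changeLevel_eq_cast_of_dvd χ _ hu.unit,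
        hu.unit_spec, ZMod.cast_natCast (dvd_mul_right D M)]
    · rw [if_neg hc, MulChar.map_nonunit _ (mt (ZMod.isUnit_iff_coprime l (D * M)).mp hc)]
  -- the coefficient `χ(l)𝟙[(l,M)=1]·κ₁(l)` is `ψ(l)κ₁(l)`
  have hcoef : ∀ l : ℕ, (if Nat.Coprime l M then kappa1 c' D l * χ (l : ZMod D) else 0) =
      ψ (l : ZMod (D * M)) * kappa1 c' D l := by
    intro l
    rw [hψ]
    by_cases hcM : Nat.Coprime l M
    · by_cases hcD : Nat.Coprime l D
      · rw [if_pos hcM, if_pos (Nat.Coprime.mul_right hcD hcM)]; ring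
      · have hχ0 : χ (l : ZMod D) = 0 :=
          MulChar.map_nonunit χ (mt (ZMod.isUnit_iff_coprime l D).mp hcD)
        rw [if_pos hcM, if_neg (fun h => hcD (Nat.Coprime.coprime_mul_right_right h)), hχ0]
        ring
    · rw [if_neg hcM, if_neg (fun h => hcM (Nat.Coprime.coprime_mul_left_right h)), zero_mul]
  have h0 : (↗ψ * ↗(MeanSquareMajorant.kappa₁ (b1 c' D) (b2 c' D))) 0 = 0 := by
    rw [Pi.mul_apply, ArithmeticFunction.map_zero, mul_zero]
  have hL : (∑' l : ℕ, if Nat.Coprime l M then kappa1 c' D l * χ (l : ZMod D) / (l : ℂ) ^ s else 0) =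
      L (↗ψ * ↗(MeanSquareMajorant.kappa₁ (b1 c' D) (b2 c' D))) s := by
    rw [LSeries]
    refine tsum_congr fun l => ?_
    rw [LSeries.term_def₀ h0, Pi.mul_apply]
    have := hcoef l
    by_cases hc : Nat.Coprime l M
    · rw [if_pos hc] at this ⊢
      rw [div_eq_mul_inv, ← cpow_neg, this, kappa1]
    · rw [if_neg hc] at this ⊢
      rw [← kappa1, ← this, zero_mul]
  have hβ₁ : beta1 c' D = (b1 c' D : ℂ) * I := by simp only [beta1, b1]; push_cast; ring
  have hβ₂ : beta2 c' D = (b2 c' D : ℂ) * I := by simp only [beta2, b2]; push_cast; ring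
  have hre1 : 1 < (s + (b1 c' D : ℂ) * I).re := by rw [MeanSquareMajorant.add_mul_I_re]; exact hs
  have hre2 : 1 < (s + (b2 c' D : ℂ) * I).re := by rw [MeanSquareMajorant.add_mul_I_re]; exact hs
  -- the Euler factors at the primes of `D` are `1`
  have hprod : ∀ w : ℂ, ∏ p ∈ (D * M).primeFactors, (1 - χ (p : ZMod D) * (p : ℂ) ^ (-w)) =
      ∏ p ∈ M.primeFactors, (1 - χ (p : ZMod D) * (p : ℂ) ^ (-w)) := by
    intro w
    symm
    refine Finset.prod_subset (Nat.primeFactors_mono (dvd_mul_left M D) (mul_ne_zero hD0 hM))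
      fun p hpN hpM => ?_
    have hp : p.Prime := Nat.prime_of_mem_primeFactors hpN
    have hpDM : p ∣ D * M := Nat.dvd_of_mem_primeFactors hpN
    have hpM' : ¬ p ∣ M := fun h => hpM (Nat.mem_primeFactors.mpr ⟨hp, h, hM⟩)
    have hpD : p ∣ D := (hp.dvd_mul.mp hpDM).resolve_right hpM'
    have hχ0 : χ (p : ZMod D) = 0 :=
      MulChar.map_nonunit χ (mt (ZMod.isUnit_iff_coprime p D).mp
        (Nat.not_coprime_of_dvd_of_dvd hp.one_lt (dvd_refl p) hpD))
    rw [hχ0, zero_mul, sub_zero]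
  rw [hL, MeanSquareMajorant.LSeries_twist_kappa₁ (b1 c' D) (b2 c' D) ψ hs, hψdef,
    DirichletCharacter.LSeries_changeLevel _ χ hs, DirichletCharacter.LSeries_changeLevel _ χ hre1,
    DirichletCharacter.LSeries_changeLevel _ χ hre2, hprod, hprod, hprod, lam1, hβ₁, hβ₂,
    DirichletCharacter.LFunction_eq_LSeries χ hs,
    DirichletCharacter.LFunction_eq_LSeries χ hre1, DirichletCharacter.LFunction_eq_LSeries χ hre2,
    Finset.prod_div_distrib, Finset.prod_mul_distrib]
  ring

open scoped Classical in
/-- **`Z22:§15.u020` DISCHARGED** (both equalities; every `D ≥ 1`, `χ`, `d₁, d₂, k ≥ 1`, `σ > 1`).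
[cite: Zhang2022LandauSiegel, §15 p. 82] -/
theorem step15_u020_holds (c' : ℝ) : Step15_u020 c' := by
  intro D _ χ d₁ d₂ k s hd₁ hd₂ hk hs
  have hm0 : d₂ * k ≠ 0 := Nat.mul_ne_zero hd₂.ne' hk.ne'
  have hM : d₁ * d₂ * k = d₁ * (d₂ * k) := mul_assoc _ _ _
  have hM0 : d₁ * d₂ * k ≠ 0 := by rw [hM]; exact Nat.mul_ne_zero hd₁.ne' hm0
  have hσ : 1 < s.re := hs
  -- the two factors of the convolution
  set A : ℕ → ℂ := fun h => if h ∈ nset d₁ ∧ Nat.Coprime h (d₂ * k) then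
    kappa1 c' D (d₁ * h) * χ (h : ZMod D) else 0 with hA
  set B : ℕ → ℂ := fun r => if Nat.Coprime r (d₁ * (d₂ * k)) then
    kappa1 c' D r * χ (r : ZMod D) else 0 with hB
  have hκ0 : kappa1 c' D 0 = 0 := by rw [kappa1]; exact ArithmeticFunction.map_zero
  have hA0 : A 0 = 0 := by
    simp only [hA]
    rw [if_neg]
    exact fun h => (lt_irrefl 0) h.1.1
  have hB0 : B 0 = 0 := by
    simp only [hB]; split_ifs <;> simp [hκ0]
  -- summability (`|κ₁| ≤ τ₃`, `Σ τ₃(d₁h)h^{−σ} < ∞`)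
  have hAn : ∀ h : ℕ, ‖A h‖ ≤ MeanSquareMajorant.tau 3 (d₁ * h) := fun h => by
    simp only [hA]
    split_ifs
    · rw [norm_mul]
      calc ‖kappa1 c' D (d₁ * h)‖ * ‖χ (h : ZMod D)‖ ≤ MeanSquareMajorant.tau 3 (d₁ * h) * 1 :=
            mul_le_mul (norm_kappa1_le_tau c' D _) (DirichletCharacter.norm_le_one χ _)
              (norm_nonneg _) (MeanSquareMajorant.tau_nonneg _ _)
        _ = _ := mul_one _
    · rw [norm_zero]; exact MeanSquareMajorant.tau_nonneg _ _
  have hBn : ∀ r : ℕ, ‖B r‖ ≤ MeanSquareMajorant.tau 3 (1 * r) := fun r => by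
    simp only [hB, one_mul]
    split_ifs
    · rw [norm_mul]
      calc ‖kappa1 c' D r‖ * ‖χ (r : ZMod D)‖ ≤ MeanSquareMajorant.tau 3 r * 1 :=
            mul_le_mul (norm_kappa1_le_tau c' D _) (DirichletCharacter.norm_le_one χ _)
              (norm_nonneg _) (MeanSquareMajorant.tau_nonneg _ _)
        _ = _ := mul_one _
    · rw [norm_zero]; exact MeanSquareMajorant.tau_nonneg _ _
  have hsumm : ∀ {F : ℕ → ℂ} {a : ℕ}, 0 < a → (∀ n, ‖F n‖ ≤ MeanSquareMajorant.tau 3 (a * n)) →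
      LSeriesSummable F s := by
    intro F a ha hF
    refine Summable.of_norm_bounded (summable_tau_three_mul_div_rpow ha hσ) fun n => ?_
    rw [LSeries.norm_term_eq]
    split_ifs with hn
    · exact div_nonneg (MeanSquareMajorant.tau_nonneg _ _) (Real.rpow_nonneg (Nat.cast_nonneg _) _)
    · exact div_le_div_of_nonneg_right (hF n) (Real.rpow_nonneg (Nat.cast_nonneg _) _)
  have hAs : LSeriesSummable A s := hsumm hd₁ hAn
  have hBs : LSeriesSummable B s := hsumm one_pos hBn
  -- the convolution `A ∗ B`
  have hconv : ∀ l : ℕ, (A ⍟ B) l =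
      if Nat.Coprime l (d₂ * k) then kappa1 c' D (d₁ * l) * χ (l : ZMod D) else 0 := by
    intro l
    rcases eq_or_ne l 0 with rfl | hl
    · rw [LSeries.convolution_map_zero]
      split_ifs <;> simp [hκ0]
    · exact split_conv_apply_kappa1 c' χ hd₁.ne' hl
  have hAB0 : (A ⍟ B) 0 = 0 := LSeries.convolution_map_zero A B
  -- the three series as `L`-series
  have hS : (∑' l₁ : ℕ, if Nat.Coprime l₁ (d₂ * k) then
        kappa1 c' D (d₁ * l₁) * χ (l₁ : ZMod D) / (l₁ : ℂ) ^ s else 0) = L (A ⍟ B) s := by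
    rw [LSeries]
    refine tsum_congr fun l => ?_
    rw [LSeries.term_def₀ hAB0, hconv l]
    split_ifs
    · rw [div_eq_mul_inv, cpow_neg]
    · rw [zero_mul]
  have hLA : L A s = kappaTilde1 c' χ d₁ (d₂ * k) s := by
    rw [kappaTilde1, LSeries]
    refine tsum_congr fun h => ?_
    rw [LSeries.term_def₀ hA0]
    simp only [hA]
    by_cases hc : h ∈ nset d₁ ∧ Nat.Coprime h (d₂ * k)
    · rw [if_pos hc, if_pos hc, div_eq_mul_inv, cpow_neg]
    · rw [if_neg hc, if_neg hc, zero_mul]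
  have hLB : L B s = ∑' l : ℕ, if Nat.Coprime l (d₁ * d₂ * k) then
      kappa1 c' D l * χ (l : ZMod D) / (l : ℂ) ^ s else 0 := by
    rw [LSeries, hM]
    refine tsum_congr fun r => ?_
    rw [LSeries.term_def₀ hB0]
    simp only [hB]
    split_ifs
    · rw [div_eq_mul_inv, cpow_neg]
    · rw [zero_mul]
  have h1 : (∑' l₁ : ℕ, if Nat.Coprime l₁ (d₂ * k) then
        kappa1 c' D (d₁ * l₁) * χ (l₁ : ZMod D) / (l₁ : ℂ) ^ s else 0) =
      kappaTilde1 c' χ d₁ (d₂ * k) s * ∑' l : ℕ, (if Nat.Coprime l (d₁ * d₂ * k) then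
        kappa1 c' D l * χ (l : ZMod D) / (l : ℂ) ^ s else 0) := by
    rw [hS, LSeries_convolution' hAs hBs, hLA, hLB]
  refine ⟨h1, ?_⟩
  rw [h1, tsum_coprime_kappa1_chi c' χ hM0 hs]
  ring

end U020

end Literature.NumberTheory.LFunctions.Zhang2022.Typed.Section15A
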